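import Literature.AlgebraicGeometry.HodgeTheory.HodgeGenericQbarDescent
import Literature.AlgebraicGeometry.HodgeTheory.DirectImageTransport
import Literature.AlgebraicGeometry.HodgeTheory.DirectImageBaseChange
import Literature.AlgebraicGeometry.HodgeTheory.GlobalInvariantCyclesSectionsProofs
import Literature.AlgebraicGeometry.HodgeTheory.MotivatedClassesDeformationInputs
import Literature.AlgebraicGeometry.HodgeTheory.HodgeConjectureQbarVoisinProofs
import Literature.AlgebraicGeometry.HodgeTheory.HodgeRiemannPolarizability
import Literature.AlgebraicGeometry.HodgeTheory.ComplexConjugationHolds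
import Literature.AlgebraicGeometry.HodgeTheory.HodgeFiltrationModelsReductionProofs
import Literature.AlgebraicGeometry.HodgeTheory.IsoTransport
import Literature.AlgebraicGeometry.Motives.ComplexPointsEtaleLocalHomeomorph
import Literature.AlgebraicGeometry.Motives.AbelianVarietyProofs
import Literature.AlgebraicGeometry.Motives.BaseChangeProofs
import HarnessLib

/-!
# Monodromy orbits on the real carriers: bricks towards `bku_finite_monodromyOrbit_of_isHodgeGenericIn`, and `voisin2007_algebraic_of_finite_monodromyOrbit_of_qbar` from its classical inputs

Companion (sorry-free, theorems only) of `HodgeGenericQbarDescent.lean`, which vendors as the named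
fact `bku_finite_monodromyOrbit_of_isHodgeGenericIn` the statement "at a Hodge-generic point every
Hodge class has finite monodromy orbit" (Baldi–Klingler–Ullmo, *On the distribution of the Hodge
locus*, §3.2: the Hodge locus `HL(S, 𝕍^⊗)` is the set of non-Hodge-generic points; Klingler–
Otwinowska–Urbanik, *On the fields of definition of Hodge loci*, §1.1.1: `HL(S, 𝕍) ⊆ HL(S, 𝕍^⊗)` is
the projection of the exceptional Hodge classes, those whose orbit under monodromy is infinite).

In that fact the "monodromy orbit" of a class `α ∈ H²ᵖ(𝒳_s(ℂ); ℂ)` is rendered on the tree's real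
carriers as the set of flat continuations of `α` along loops at `s` in the espace étalé
`FiberClass f (2p)` of `R²ᵖ f_* ℂ` (`IsContinuationAlong`, file `HodgeLocus`). The published proof
(Baldi–Klingler–Ullmo §3.2, after Deligne's theorem of the fixed part and semisimplicity theorem
and André 1992: the connected algebraic monodromy group `H_S` is a normal subgroup of the derived
generic Mumford–Tate group, so that at a Hodge-generic point a finite-index subgroup of `π₁(S^an, s)`
fixes every Hodge class) ends with two formal steps, which are what this file proves:

* `isContinuationAlong_iff_transportFun_eq`, `setOf_isContinuationAlong_eq_range_transportFun` —
  when `R^k f_* ℂ` is a local system on `S(ℂ)` (`IsCohomologicallyLocallyTrivialOn f univ`, the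
  conclusion of Ehresmann's theorem, PROVED for smooth projective families over an equidimensional
  smooth quasi-projective base: `isCohomologicallyLocallyTrivialOn_univ_of_isSmoothProjectiveFamily`)
  the continuations of `α` along a loop `γ` are unique and equal to the transport
  `transportFun f k hU ⟦γ⟧ α` (unique path lifting in the covering space `FiberClass f k → S(ℂ)`,
  `transportFun_eq_of_path`, `exists_path_transportFun`), so that **the set of continuations along
  loops is the orbit of `α` under the monodromy representation of `π₁(S(ℂ), s)`**
  (Voisin, *Hodge Theory I*, §9.2.1; Hatcher Prop. 1.34);
* `finite_setOf_isContinuationAlong_of_finiteIndex` — **the orbit is finite as soon as a subgroup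
  of finite index of `π₁(S(ℂ), s)` fixes `α`** (orbit–stabiliser: the orbit map factors through the
  finite coset space), and its hypothesis-free form over an equidimensional base,
  `finite_setOf_isContinuationAlong_of_finiteIndex_of_isSmoothProjectiveFamily`.

What is NOT here (and why `bku_finite_monodromyOrbit_of_isHodgeGenericIn_holds` is not proved): the
Hodge-theoretic input producing the finite-index subgroup — at a point where `dim MT(H²ᵖ(𝒳_s))` is
maximal every Hodge class is generic (stays Hodge under every transport; holomorphy of the Hodge
filtration of `R²ᵖ f_* ℂ`, analyticity of Hodge loci, Baire) and generic rational Hodge classes have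
finite monodromy orbits (flat integral structure and a flat polarization definite on real
`(p,p)`-classes; Cattani–Deligne–Kaplan §1) — none of which exists on the tree's real carriers; the
hypothesis structure `Motives.GeometricVHSData` of the fact pins only the pointwise Hodge structures,
not its transport, to the étalé space.

## Bricks towards `voisin2007_algebraic_of_finite_monodromyOrbit_of_qbar` (same fact file)

The sibling fact renders the last paragraph of Voisin's proof of Prop. 0.7 (= arXiv Prop. 1.7;
*Hodge loci and absolute Hodge classes*, §3): *"As monodromy acts in a finite way on the set of Hodge
classes …, there is an étale cover `S''` of the smooth part of `S'`, also defined over `ℚ̄`, on which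
this monodromy action becomes trivial"*, followed by the global invariant cycle theorem on a smooth
compactification defined over `ℚ̄` and the Hodge conjecture over `ℚ̄`. Its first, purely topological
step is the CONVERSE of `finite_setOf_isContinuationAlong_of_finiteIndex`, proved here:

* `exists_finiteIndex_of_finite_setOf_isContinuationAlong` — **a class with finite monodromy orbit
  is fixed under transport by a subgroup of finite index of `π₁(S(ℂ), s)`** (its stabiliser: the
  orbit is in bijection with the coset space, Mathlib `MulAction.orbitEquivQuotientStabilizer`), with
  the equivalence `finite_setOf_isContinuationAlong_iff_exists_finiteIndex`, the hypothesis-free form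
  `exists_finiteIndex_of_finite_setOf_isContinuationAlong_of_isSmoothProjectiveFamily` over an
  equidimensional base, and the form on the EXACT hypotheses of the fact,
  `exists_finiteIndex_of_finite_setOf_isContinuationAlong_of_qbarFamily`: for the complexification
  `f = f₀ ⊗_σ ℂ` of a `ℚ̄`-morphism onto a smooth irreducible quasi-projective `S₀` (smooth with
  irreducible source is smooth of some relative dimension `d`,
  `Motives.exists_smoothOfRelativeDimension_of_smooth`; both properties pass to `S₀ ⊗_σ ℂ`,
  `smoothOfRelativeDimension_baseChangeHom_hom`, `IsQuasiProjectiveOver.baseChangeHom`), so that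
  `R^k f_* ℂ` is a local system on `S(ℂ)` and the finite-orbit hypothesis of the fact IS a finite-index
  subgroup of `π₁(S(ℂ), s)` fixing `α` — the subgroup whose finite étale cover (Riemann's existence
  theorem, SGA1 XII Thm. 5.1, not in the tree) is Voisin's `S''`.

* `forall_transportFun_familyPullback_eq`, `exists_continuous_section_familyPullback` — **"on
  which this monodromy action becomes trivial … a global section `α̃` of `R^{2k}π''_*ℚ` whose
  restriction to `X_0` is `α`"**: over a base change `g : S' ⟶ S` inducing a local homeomorphism
  `g(ℂ)` (e.g. étale between smooth `ℂ`-schemes), if the images of the loops at `s'` fix `α`, then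
  the transferred class `α' = e^* α` on `X'_{s'} ≅ X_{g s'}` is fixed by the monodromy of the
  base-changed family (transport commutes with base change, `FiberClass.baseChange_transportFun`)
  and extends to a continuous global section of its espace étalé (Voisin II Lemma 4.17,
  `exists_continuous_section_of_forall_transportFun_eq`) — the input shape of
  `deligne_globalInvariantCycles`.
* `voisin2007_algebraic_of_finite_monodromyOrbit_of_qbar_of_classical_inputs` — **the whole
  paragraph assembled**: the fact PROVED from five inputs taken as hypotheses, each a published
  theorem in the shape consumed — Riemann's existence theorem with descent of finite étale covers
  to `ℚ̄` (SGA1 XII Thm. 5.1, XIII Prop. 4.6), a smooth projective compactification defined over `ℚ̄`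
  of the base-changed family (Nagata + Hironaka over `ℚ̄`; the tree's
  `Hironaka1964_smoothCompactification` is over `ℂ` and for a single variety), the global invariant
  cycle theorem (the named fact `deligne_globalInvariantCycles`), the polarisability of the Hodge
  structures of smooth projective varieties (the named fact
  `smoothProjective_hodgeStructure_isPolarizable`, through the tree's proved Hodge lift
  `deligne_globalInvariantCycles.exists_hodgeClass_eq_globalSection_of_exists_isReal_hodgeModel`),
  and the contravariance of algebraic classes for morphisms of smooth projective varieties (Fulton
  1998, Cor. 19.2 (b); the tree proves the flat case `map_mem_algebraicClasses_of_flat`). The first,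
  second and fifth inputs have no declaration in the tree; this file introduces none.

## References

* [BaldiKlinglerUllmo2024] G. Baldi, B. Klingler, E. Ullmo, Invent. Math. 235 (2024), §3.2.
* [KlinglerOtwinowskaUrbanik2023] B. Klingler, A. Otwinowska, D. Urbanik, Ann. Sci. ÉNS 56 (2023), §1.1.1.
* [VoisinHodgeI2002] C. Voisin, Hodge Theory and Complex Algebraic Geometry I, CUP 2002, §9.2.1, Thm. 9.3.
* [HatcherAT2002] A. Hatcher, Algebraic Topology, CUP 2002, §1.3 Prop. 1.34.
* [Voisin2007HodgeLoci] C. Voisin, Hodge loci and absolute Hodge classes, Compositio Math. 143 (2007),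
  §3, proof of Prop. 0.7 (arXiv math/0605766, Prop. 1.7, p. 7).
* [Liu2002] Q. Liu, Algebraic Geometry and Arithmetic Curves, OUP 2002, Prop. 3.1.23, Rem. 3.1.20,
  Prop. 4.3.38 (base change of immersions, projectivity, smoothness).
* [VoisinHodgeII2003] C. Voisin, Hodge Theory and Complex Algebraic Geometry II, CUP 2003, §3.1.2,
  Lemma 4.17.
* [SGA1] A. Grothendieck, M. Raynaud, SGA 1, Exp. XII Thm. 5.1 (Riemann's existence theorem),
  Prop. 2.4, Prop. 3.1 (iii); Exp. XIII Prop. 4.6 (invariance of `π₁` under algebraically closed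
  extension in characteristic `0`).
* [DeligneHodgeII1971] P. Deligne, Théorie de Hodge II, Publ. Math. IHÉS 40 (1971), Thm. 4.1.1.
* [CharlesSchnell2014Notes] F. Charles, C. Schnell, Notes on absolute Hodge classes (2014),
  Thm. 11.3.4, Prop. 11.3.5, Thm. 11.3.19.
* [Fulton1998] W. Fulton, Intersection Theory, 2nd ed. 1998, Lemma 19.1.1, Cor. 19.2 (b).
* [Hironaka1964] H. Hironaka, Ann. of Math. 79 (1964), Main Theorem I.
-/

noncomputable section

open CategoryTheory AlgebraicGeometry
open _root_.Topology
open Literature.AlgebraicTopology.SingularHomology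

namespace Literature.AlgebraicGeometry.HodgeTheory

section HodgeTheory

variable {𝒳 S : Motives.SchemeOver ℂ} (f : 𝒳 ⟶ S) (k : ℕ)

/-! ### Continuations along paths are transports -/

/-- **Continuation along a path is transport.** If `Rᵏ f_* ℂ` is a local system on `S(ℂ)`
(`f` cohomologically locally trivial by restriction over `S(ℂ)`), then `β` is a flat continuation of
`α` along the path `γ` from `s` to `t` iff `β` is the transport of `α` along (the homotopy class of)
`γ`: lifts of `γ` to the covering space `FiberClass f k → S(ℂ)` starting at `(s, α)` exist and are
unique (Hatcher Prop. 1.34; Voisin I §9.2.1, "`Rᵏ π_* A` is a local system").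
[cite: VoisinHodgeI2002, §9.2.1] [cite: HatcherAT2002, §1.3 Prop. 1.34] -/
theorem isContinuationAlong_iff_transportFun_eq
    (hU : IsCohomologicallyLocallyTrivialOn f (Set.univ : Set (Motives.ComplexPoints S)))
    {s t : Motives.ComplexPoints S} (γ : Path s t) (α : complexBetti (Motives.fiberOver f s) k)
    (β : complexBetti (Motives.fiberOver f t) k) :
    IsContinuationAlong γ α β ↔
      transportFun f k hU (s := ⟨s, Set.mem_univ s⟩) (t := ⟨t, Set.mem_univ t⟩)
        ⟦γ.map (continuous_id.subtype_mk fun x ↦ Set.mem_univ x)⟧ α = β := by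
  constructor
  · rintro ⟨Γ, hΓ⟩
    exact transportFun_eq_of_path f k hU _ Γ fun u ↦ hΓ u
  · rintro rfl
    obtain ⟨Γ, hΓ⟩ := exists_path_transportFun f k hU (s := ⟨s, Set.mem_univ s⟩)
      (t := ⟨t, Set.mem_univ t⟩) (γ.map (continuous_id.subtype_mk fun x ↦ Set.mem_univ x)) α
    exact ⟨Γ, fun u ↦ hΓ u⟩

/-- **The set of continuations along loops is the monodromy orbit.** If `Rᵏ f_* ℂ` is a local system
on `S(ℂ)`, the set of flat continuations of `α ∈ Hᵏ(𝒳_s(ℂ); ℂ)` along loops at `s` (the "monodromy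
orbit" of the named fact `bku_finite_monodromyOrbit_of_isHodgeGenericIn`) is the set of transports
`γ_* α` of `α` along the homotopy classes of loops `γ` at `s`, i.e. the orbit of `α` under the
monodromy representation of `π₁(S(ℂ), s)` on `Hᵏ(𝒳_s(ℂ); ℂ)`. [cite: VoisinHodgeI2002, §9.2.1] -/
theorem setOf_isContinuationAlong_eq_range_transportFun
    (hU : IsCohomologicallyLocallyTrivialOn f (Set.univ : Set (Motives.ComplexPoints S)))
    (s : Motives.ComplexPoints S) (α : complexBetti (Motives.fiberOver f s) k) :
    {β : complexBetti (Motives.fiberOver f s) k | ∃ γ : Path s s, IsContinuationAlong γ α β} =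
      Set.range fun γ : Path.Homotopic.Quotient
          (⟨s, Set.mem_univ s⟩ : (Set.univ : Set (Motives.ComplexPoints S))) ⟨s, Set.mem_univ s⟩ ↦
        transportFun f k hU γ α := by
  ext β
  constructor
  · rintro ⟨γ, hγ⟩
    exact ⟨_, (isContinuationAlong_iff_transportFun_eq f k hU γ α β).1 hγ⟩
  · rintro ⟨γ, rfl⟩
    induction γ using Quotient.ind with
    | _ γ =>
      obtain ⟨Γ, hΓ⟩ := exists_path_transportFun f k hU γ α
      exact ⟨γ.map continuous_subtype_val, Γ, fun u ↦ hΓ u⟩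

/-- In particular `α` itself lies in its monodromy orbit (constant loop). [folklore] -/
theorem self_mem_setOf_isContinuationAlong (s : Motives.ComplexPoints S)
    (α : complexBetti (Motives.fiberOver f s) k) :
    α ∈ {β : complexBetti (Motives.fiberOver f s) k | ∃ γ : Path s s, IsContinuationAlong γ α β} :=
  ⟨Path.refl s, IsContinuationAlong.refl α⟩

/-! ### Finite orbits from finite-index stabilisers -/

/-- **A class fixed by a finite-index subgroup of `π₁` has finite monodromy orbit.** If `Rᵏ f_* ℂ` is a
local system on `S(ℂ)` and a subgroup `H ≤ π₁(S(ℂ), s)` of finite index fixes `α ∈ Hᵏ(𝒳_s(ℂ); ℂ)`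
under transport, then the set of flat continuations of `α` along loops at `s` is finite: by
`setOf_isContinuationAlong_eq_range_transportFun` it is the orbit of `α` under the monodromy
representation, and the orbit map factors through the finite coset space `π₁ / H`. This is the formal
last step of "at a Hodge-generic point every Hodge class has finite monodromy orbit" (Baldi–Klingler–
Ullmo §3.2 with André 1992: a finite-index subgroup of monodromy lies in the derived Mumford–Tate
group, which fixes Hodge classes). [cite: BaldiKlinglerUllmo2024, §3.2] -/
theorem finite_setOf_isContinuationAlong_of_finiteIndex
    (hU : IsCohomologicallyLocallyTrivialOn f (Set.univ : Set (Motives.ComplexPoints S)))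
    (s : Motives.ComplexPoints S) (α : complexBetti (Motives.fiberOver f s) k)
    (H : Subgroup (FundamentalGroup (Set.univ : Set (Motives.ComplexPoints S)) ⟨s, Set.mem_univ s⟩))
    [H.FiniteIndex]
    (hH : ∀ γ ∈ H, transportFun f k hU (FundamentalGroup.toPath γ) α = α) :
    {β : complexBetti (Motives.fiberOver f s) k | ∃ γ : Path s s, IsContinuationAlong γ α β}.Finite := by
  rw [setOf_isContinuationAlong_eq_range_transportFun f k hU s α]
  -- the monodromy representation of the local system `Rᵏ f_* ℂ` on the real carriers
  set ρ := (localSystemOfRestrict f k hU).monodromyRep ⟨s, Set.mem_univ s⟩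
  have hρ : ∀ g, ρ g α = transportFun f k hU (FundamentalGroup.toPath g) α := fun g ↦ rfl
  refine (Set.finite_range fun q : _ ⧸ H ↦ ρ q.out α).subset ?_
  rintro _ ⟨γ, rfl⟩
  obtain ⟨h, hh⟩ := QuotientGroup.mk_out_eq_mul H (FundamentalGroup.fromPath γ)
  refine ⟨QuotientGroup.mk (FundamentalGroup.fromPath γ), ?_⟩
  change ρ (QuotientGroup.mk (s := H) (FundamentalGroup.fromPath γ)).out α = _
  rw [hh, map_mul, Module.End.mul_apply, hρ h, hH h h.2, hρ]

/-- **Hypothesis-free form over an equidimensional base.** For a smooth projective family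
`f : 𝒳 ⟶ S` of relative dimension `n` over a quasi-projective base `S` smooth of pure dimension `d`
over `ℂ`, `Rᵏ f_* ℂ` IS a local system on `S(ℂ)` (Ehresmann's theorem on complex points and homotopy
invariance, `isCohomologicallyLocallyTrivialOn_univ_of_isSmoothProjectiveFamily`); hence a class
`α ∈ Hᵏ(𝒳_s(ℂ); ℂ)` fixed under transport by a finite-index subgroup of `π₁(S(ℂ), s)` has a finite set
of flat continuations along loops at `s`. [cite: VoisinHodgeI2002, Thm. 9.3 and §9.2.1]
[cite: BaldiKlinglerUllmo2024, §3.2] -/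
theorem finite_setOf_isContinuationAlong_of_finiteIndex_of_isSmoothProjectiveFamily {n : ℕ} (d : ℕ)
    (hf : Motives.IsSmoothProjectiveFamily f n) (hS : IsQuasiProjectiveOver S)
    [SmoothOfRelativeDimension d S.hom]
    (s : Motives.ComplexPoints S) (α : complexBetti (Motives.fiberOver f s) k)
    (H : Subgroup (FundamentalGroup (Set.univ : Set (Motives.ComplexPoints S)) ⟨s, Set.mem_univ s⟩))
    [H.FiniteIndex]
    (hH : ∀ γ ∈ H, transportFun f k
      (isCohomologicallyLocallyTrivialOn_univ_of_isSmoothProjectiveFamily f d hf hS)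
      (FundamentalGroup.toPath γ) α = α) :
    {β : complexBetti (Motives.fiberOver f s) k | ∃ γ : Path s s, IsContinuationAlong γ α β}.Finite :=
  finite_setOf_isContinuationAlong_of_finiteIndex f k _ s α H hH

/-! ### Finite orbits have finite-index stabilisers (Voisin 2007, §3, proof of Prop. 0.7) -/

/-- **A class with finite monodromy orbit is fixed under transport by a finite-index subgroup of
`π₁(S(ℂ), s)`** — the converse of `finite_setOf_isContinuationAlong_of_finiteIndex`, and the first
step of the last paragraph of Voisin's proof of Prop. 0.7 ("As monodromy acts in a finite way on the
set of Hodge classes …, there is an étale cover … on which this monodromy action becomes trivial":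
the cover is the one attached to this subgroup). If `Rᵏ f_* ℂ` is a local system on `S(ℂ)` and the
set of flat continuations of `α ∈ Hᵏ(𝒳_s(ℂ); ℂ)` along loops at `s` is finite, then the stabiliser of
`α` under the monodromy representation has finite index (the orbit, which is that set by
`setOf_isContinuationAlong_eq_range_transportFun`, is in bijection with the coset space of the
stabiliser) and fixes `α`. [cite: Voisin2007HodgeLoci, §3, proof of Prop. 0.7 (arXiv Prop. 1.7, p. 7)]
[cite: VoisinHodgeI2002, §9.2.1] -/
theorem exists_finiteIndex_of_finite_setOf_isContinuationAlong
    (hU : IsCohomologicallyLocallyTrivialOn f (Set.univ : Set (Motives.ComplexPoints S)))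
    (s : Motives.ComplexPoints S) (α : complexBetti (Motives.fiberOver f s) k)
    (hfin : {β : complexBetti (Motives.fiberOver f s) k |
      ∃ γ : Path s s, IsContinuationAlong γ α β}.Finite) :
    ∃ H : Subgroup (FundamentalGroup (Set.univ : Set (Motives.ComplexPoints S)) ⟨s, Set.mem_univ s⟩),
      H.FiniteIndex ∧ ∀ γ ∈ H, transportFun f k hU (FundamentalGroup.toPath γ) α = α := by
  rw [setOf_isContinuationAlong_eq_range_transportFun f k hU s α] at hfin
  -- the monodromy representation of `Rᵏ f_* ℂ` at `s` and the induced action of `π₁(S(ℂ), s)`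
  let ρ : FundamentalGroup (Set.univ : Set (Motives.ComplexPoints S)) ⟨s, Set.mem_univ s⟩ →*
      Module.End ℂ (complexBetti (Motives.fiberOver f s) k) :=
    (localSystemOfRestrict f k hU).monodromyRep ⟨s, Set.mem_univ s⟩
  letI : MulAction (FundamentalGroup (Set.univ : Set (Motives.ComplexPoints S)) ⟨s, Set.mem_univ s⟩)
      (complexBetti (Motives.fiberOver f s) k) := MulAction.compHom _ ρ
  have hsmul : ∀ g : FundamentalGroup (Set.univ : Set (Motives.ComplexPoints S)) ⟨s, Set.mem_univ s⟩,
      g • α = transportFun f k hU (FundamentalGroup.toPath g) α := fun _ ↦ rfl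
  -- the orbit of `α` is contained in (indeed equal to) the finite set of continuations along loops
  have horb : (MulAction.orbit
      (FundamentalGroup (Set.univ : Set (Motives.ComplexPoints S)) ⟨s, Set.mem_univ s⟩) α).Finite := by
    refine hfin.subset ?_
    rintro _ ⟨g, rfl⟩
    exact ⟨FundamentalGroup.toPath g, (hsmul g).symm⟩
  haveI := horb.to_subtype
  haveI : Finite (FundamentalGroup (Set.univ : Set (Motives.ComplexPoints S)) ⟨s, Set.mem_univ s⟩ ⧸
      MulAction.stabilizer
        (FundamentalGroup (Set.univ : Set (Motives.ComplexPoints S)) ⟨s, Set.mem_univ s⟩) α) :=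
    Finite.of_equiv _ (MulAction.orbitEquivQuotientStabilizer _ α)
  refine ⟨MulAction.stabilizer _ α, Subgroup.finiteIndex_of_finite_quotient, fun γ hγ ↦ ?_⟩
  rw [← hsmul]
  exact MulAction.mem_stabilizer_iff.1 hγ

/-- **Finite monodromy orbit ⟺ fixed by a finite-index subgroup of `π₁(S(ℂ), s)`**, for a class
`α ∈ Hᵏ(𝒳_s(ℂ); ℂ)` when `Rᵏ f_* ℂ` is a local system on `S(ℂ)` (the two directions are
`exists_finiteIndex_of_finite_setOf_isContinuationAlong` and
`finite_setOf_isContinuationAlong_of_finiteIndex`). [cite: VoisinHodgeI2002, §9.2.1]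
[cite: Voisin2007HodgeLoci, §3, proof of Prop. 0.7 (arXiv Prop. 1.7, p. 7)] -/
theorem finite_setOf_isContinuationAlong_iff_exists_finiteIndex
    (hU : IsCohomologicallyLocallyTrivialOn f (Set.univ : Set (Motives.ComplexPoints S)))
    (s : Motives.ComplexPoints S) (α : complexBetti (Motives.fiberOver f s) k) :
    {β : complexBetti (Motives.fiberOver f s) k | ∃ γ : Path s s, IsContinuationAlong γ α β}.Finite ↔
      ∃ H : Subgroup (FundamentalGroup (Set.univ : Set (Motives.ComplexPoints S)) ⟨s, Set.mem_univ s⟩),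
        H.FiniteIndex ∧ ∀ γ ∈ H, transportFun f k hU (FundamentalGroup.toPath γ) α = α := by
  refine ⟨exists_finiteIndex_of_finite_setOf_isContinuationAlong f k hU s α, ?_⟩
  rintro ⟨H, hH, h⟩
  exact finite_setOf_isContinuationAlong_of_finiteIndex f k hU s α H h

/-- **Hypothesis-free form over an equidimensional base.** For a smooth projective family
`f : 𝒳 ⟶ S` of relative dimension `n` over a quasi-projective base `S` smooth of pure dimension `d`
over `ℂ` (so that `Rᵏ f_* ℂ` IS a local system on `S(ℂ)`,
`isCohomologicallyLocallyTrivialOn_univ_of_isSmoothProjectiveFamily`), a class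
`α ∈ Hᵏ(𝒳_s(ℂ); ℂ)` with finitely many flat continuations along loops at `s` is fixed under transport
by a finite-index subgroup of `π₁(S(ℂ), s)`. [cite: VoisinHodgeI2002, Thm. 9.3 and §9.2.1]
[cite: Voisin2007HodgeLoci, §3, proof of Prop. 0.7 (arXiv Prop. 1.7, p. 7)] -/
theorem exists_finiteIndex_of_finite_setOf_isContinuationAlong_of_isSmoothProjectiveFamily {n : ℕ}
    (d : ℕ) (hf : Motives.IsSmoothProjectiveFamily f n) (hS : IsQuasiProjectiveOver S)
    [SmoothOfRelativeDimension d S.hom]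
    (s : Motives.ComplexPoints S) (α : complexBetti (Motives.fiberOver f s) k)
    (hfin : {β : complexBetti (Motives.fiberOver f s) k |
      ∃ γ : Path s s, IsContinuationAlong γ α β}.Finite) :
    ∃ H : Subgroup (FundamentalGroup (Set.univ : Set (Motives.ComplexPoints S)) ⟨s, Set.mem_univ s⟩),
      H.FiniteIndex ∧ ∀ γ ∈ H, transportFun f k
        (isCohomologicallyLocallyTrivialOn_univ_of_isSmoothProjectiveFamily f d hf hS)
        (FundamentalGroup.toPath γ) α = α :=
  exists_finiteIndex_of_finite_setOf_isContinuationAlong f k _ s α hfin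

end HodgeTheory

/-! ### The base of a `ℚ̄`-family: quasi-projectivity and equidimensionality pass to `S₀ ⊗_σ ℂ` -/

section QbarFamily

universe u

/-- **Quasi-projectivity is stable under extension of the base field** along `σ : k →+* L`: an open
`k`-immersion `X ↪ P` into a projective `k`-scheme base-changes to an open `L`-immersion
`X_σ ↪ P_σ` (the square is cartesian, Liu 2002, Rem. 3.1.20; open immersions are stable under base
change) into the projective `L`-scheme `P_σ` (Liu 2002, Prop. 3.1.23 with Ex. 3.1.10; the tree's
`Motives.IsProjectiveOver.baseChange_obj`). [cite: Liu2002, Prop. 3.1.23 and Rem. 3.1.20] -/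
theorem IsQuasiProjectiveOver.baseChangeHom {k L : Type u} [Field k] [Field L] (σ : k →+* L)
    {X : Motives.SchemeOver k} (h : IsQuasiProjectiveOver X) :
    IsQuasiProjectiveOver ((Motives.baseChangeHom σ).obj X) := by
  obtain ⟨P, j, hP, hj⟩ := h
  letI := σ.toAlgebra
  refine ⟨(Motives.baseChangeHom σ).obj P, (Motives.baseChangeHom σ).map j, hP.baseChange_obj L, ?_⟩
  exact MorphismProperty.IsStableUnderBaseChange.of_isPullback
    (Motives.isPullback_baseChange_map_left L j).flip hj

/-- **Smoothness of relative dimension `d` passes to the base change** `X_σ → Spec L` of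
`X → Spec k` along `σ : k →+* L` (Hartshorne III Prop. 10.1 (b); Liu 2002, Prop. 4.3.38; Mathlib
`smoothOfRelativeDimension_isStableUnderBaseChange`, the structure map of `X_σ` being the second
projection of `X ×_{Spec k} Spec L`). [cite: Liu2002, Prop. 4.3.38] -/
theorem smoothOfRelativeDimension_baseChangeHom_hom {k L : Type u} [Field k] [Field L]
    (σ : k →+* L) (d : ℕ) (X : Motives.SchemeOver k) [h : SmoothOfRelativeDimension d X.hom] :
    SmoothOfRelativeDimension d ((Motives.baseChangeHom σ).obj X).hom :=
  have := smoothOfRelativeDimension_isStableUnderBaseChange d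
  MorphismProperty.pullback_snd (P := @SmoothOfRelativeDimension d) _ _ h

/-- **On the exact hypotheses of `voisin2007_algebraic_of_finite_monodromyOrbit_of_qbar`: the
finite-orbit hypothesis is a finite-index subgroup of `π₁(S(ℂ), s)` fixing `α`.** For an embedding
`σ : ℚ̄ →+* ℂ`, a `ℚ̄`-morphism `f₀ : 𝒳₀ ⟶ S₀` onto a smooth irreducible quasi-projective `S₀` whose
complexification `f = f₀ ⊗_σ ℂ` is a smooth projective family of relative dimension `n`, a complex
point `s` of `S = S₀ ⊗_σ ℂ` and a class `α ∈ Hᵏ(𝒳_s(ℂ); ℂ)` with finitely many flat continuations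
along loops at `s`: `Rᵏ f_* ℂ` is a local system on `S(ℂ)` (`S₀` is smooth of some relative
dimension `d`, `Motives.exists_smoothOfRelativeDimension_of_smooth`, hence so is `S`, and `S` is
quasi-projective) and some subgroup of finite index of `π₁(S(ℂ), s)` fixes `α` under transport — "as
monodromy acts in a finite way … there is an étale cover [of finite degree] … on which this monodromy
action becomes trivial". [cite: Voisin2007HodgeLoci, §3, proof of Prop. 0.7 (arXiv Prop. 1.7, p. 7)]
[cite: VoisinHodgeI2002, Thm. 9.3 and §9.2.1] -/
theorem exists_finiteIndex_of_finite_setOf_isContinuationAlong_of_qbarFamily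
    (σ : AlgebraicClosure ℚ →+* ℂ) {𝒳₀ S₀ : Motives.SchemeOver (AlgebraicClosure ℚ)} (f₀ : 𝒳₀ ⟶ S₀)
    {n : ℕ} (k : ℕ) (hS₀ : IsQuasiProjectiveOver S₀) [IrreducibleSpace S₀.left]
    (hsm : AlgebraicGeometry.Smooth S₀.hom)
    (hf : Motives.IsSmoothProjectiveFamily ((Motives.baseChangeHom σ).map f₀) n)
    (s : Motives.ComplexPoints ((Motives.baseChangeHom σ).obj S₀))
    (α : complexBetti (Motives.fiberOver ((Motives.baseChangeHom σ).map f₀) s) k)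
    (hfin : {β : complexBetti (Motives.fiberOver ((Motives.baseChangeHom σ).map f₀) s) k |
      ∃ γ : Path s s, IsContinuationAlong γ α β}.Finite) :
    ∃ (hU : IsCohomologicallyLocallyTrivialOn ((Motives.baseChangeHom σ).map f₀)
        (Set.univ : Set (Motives.ComplexPoints ((Motives.baseChangeHom σ).obj S₀))))
      (H : Subgroup (FundamentalGroup
        (Set.univ : Set (Motives.ComplexPoints ((Motives.baseChangeHom σ).obj S₀)))
          ⟨s, Set.mem_univ s⟩)),
      H.FiniteIndex ∧ ∀ γ ∈ H,
        transportFun ((Motives.baseChangeHom σ).map f₀) k hU (FundamentalGroup.toPath γ) α = α := by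
  haveI := hsm
  obtain ⟨d, hd⟩ := Motives.exists_smoothOfRelativeDimension_of_smooth S₀.hom
  haveI := hd
  haveI := smoothOfRelativeDimension_baseChangeHom_hom σ d S₀
  exact ⟨_, exists_finiteIndex_of_finite_setOf_isContinuationAlong_of_isSmoothProjectiveFamily _ k d
    hf (hS₀.baseChangeHom σ) s α hfin⟩

end QbarFamily

/-! ### "This monodromy action becomes trivial" on an étale cover: the global section upstairs -/

section EtaleCover

variable {𝒳 S S' : Motives.SchemeOver ℂ} (π : 𝒳 ⟶ S) (g : S' ⟶ S) (k : ℕ)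

/-- Pull-back along an isomorphism of `ℂ`-schemes is injective on `Hᵏ(–(ℂ); ℂ)` (it has the
pull-back along the inverse as a left inverse). [folklore] -/
theorem complexBetti.map_injective_of_iso {X Y : Motives.SchemeOver ℂ} (e : X ≅ Y) (k : ℕ) :
    Function.Injective (complexBetti.map e.hom k) := by
  intro a b h
  have key : ∀ c : complexBetti Y k, complexBetti.map e.inv k (complexBetti.map e.hom k c) = c := by
    intro c
    rw [← ModuleCat.comp_apply, ← complexBetti.map_comp, Iso.inv_hom_id, complexBetti.map_id]
    rfl
  rw [← key a, ← key b, h]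

/-- **On a cover over which the loops act trivially downstairs, the monodromy of the base-changed
family fixes the class** (Voisin 2007, §3, proof of Prop. 0.7: "there is an étale cover `S''` … on
which this monodromy action becomes trivial. Thus we have by base change a family
`π'' : 𝒳_{S''} → S''` …"). Let `g : S' ⟶ S` induce a local homeomorphism `g(ℂ)` (e.g. `g` étale
between smooth `ℂ`-schemes), `S` separated, `Rᵏ π_* ℂ` and `Rᵏ π'_* ℂ` local systems on `S(ℂ)`,
`S'(ℂ)` for `π` and the base change `π' : 𝒳 ×_S S' ⟶ S'`, `s' ∈ S'(ℂ)` and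
`α' ∈ Hᵏ(X'_{s'}(ℂ); ℂ)` with transfer `(g s', α)`, `α = (X_{g s'} ≅ X'_{s'})^* α'`. If the transport
of `α` along the image `g ∘ γ'` of EVERY loop `γ'` at `s'` is `α` (e.g. `g_* π₁(S'(ℂ), s')` lies in a
subgroup fixing `α`), then the transport of `α'` along every loop at `s'` in `π'` is `α'`: transport
commutes with base change (`FiberClass.baseChange_transportFun`) and the transfer is injective on
the fibre over `s'` (a pull-back along an isomorphism of fibres).
[cite: Voisin2007HodgeLoci, §3, proof of Prop. 0.7 (arXiv Prop. 1.7, p. 7)]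
[cite: VoisinHodgeII2003, §3.1.2] -/
theorem forall_transportFun_familyPullback_eq [IsSeparated S.hom]
    (hg : IsLocalHomeomorph
      (Motives.AlgPoints.map g : Motives.ComplexPoints S' → Motives.ComplexPoints S))
    (hU : IsCohomologicallyLocallyTrivialOn π (Set.univ : Set (Motives.ComplexPoints S)))
    (hU' : IsCohomologicallyLocallyTrivialOn (Motives.familyPullback.snd π g)
      (Set.univ : Set (Motives.ComplexPoints S')))
    (s' : Motives.ComplexPoints S')
    (α' : complexBetti (Motives.fiberOver (Motives.familyPullback.snd π g) s') k)
    {α : complexBetti (Motives.fiberOver π (Motives.AlgPoints.map g s')) k}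
    (hα : (FiberClass.baseChange π g k ⟨s', α'⟩).cls = α)
    (hinv : ∀ γ' : Path (⟨s', Set.mem_univ s'⟩ : (Set.univ : Set (Motives.ComplexPoints S')))
        ⟨s', Set.mem_univ s'⟩,
      transportFun π k hU
          (s := ⟨Motives.AlgPoints.map g s', Set.mem_univ _⟩)
          (t := ⟨Motives.AlgPoints.map g s', Set.mem_univ _⟩)
          ⟦γ'.map ((((Motives.AlgPoints.continuous_map g).comp continuous_subtype_val)).subtype_mk
            fun _ ↦ Set.mem_univ _)⟧ α = α) :
    ∀ γ' : Path.Homotopic.Quotient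
        (⟨s', Set.mem_univ s'⟩ : (Set.univ : Set (Motives.ComplexPoints S'))) ⟨s', Set.mem_univ s'⟩,
      transportFun (Motives.familyPullback.snd π g) k hU' γ' α' = α' := by
  subst hα
  intro γ'
  induction γ' using Quotient.ind with
  | _ γ' =>
    have h₀ : (⟨(⟨Motives.AlgPoints.map g s', Set.mem_univ _⟩ :
          (Set.univ : Set (Motives.ComplexPoints S))).1,
        (FiberClass.baseChange π g k ⟨s', α'⟩).cls⟩ : FiberClass π k) =
        FiberClass.baseChange π g k ⟨s', α'⟩ := rfl
    have key := FiberClass.baseChange_transportFun π g k hg hU hU'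
      (s := ⟨Motives.AlgPoints.map g s', Set.mem_univ _⟩)
      (t := ⟨Motives.AlgPoints.map g s', Set.mem_univ _⟩)
      (γ'.map ((((Motives.AlgPoints.continuous_map g).comp continuous_subtype_val)).subtype_mk
        fun _ ↦ Set.mem_univ _)) γ' (fun _ ↦ rfl) α' h₀
    rw [hinv γ'] at key
    -- `key : (g s', α) = transfer (s', γ'_* α')`; compare classes and cancel the fibre isomorphism
    have hcls := (FiberClass.mk_eq_mk_iff _ _).1 key
    change complexBetti.map (Motives.fiberOverFamilyPullbackIso π g s').inv k α' =
      complexBetti.map (Motives.fiberOverFamilyPullbackIso π g s').inv k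
        (transportFun (Motives.familyPullback.snd π g) k hU' (s := ⟨s', Set.mem_univ s'⟩)
          (t := ⟨s', Set.mem_univ s'⟩) ⟦γ'⟧ α') at hcls
    exact (complexBetti.map_injective_of_iso (Motives.fiberOverFamilyPullbackIso π g s').symm k
      hcls).symm

/-- **The global section upstairs** ("Thus we have by base change a family `π'' : 𝒳_{S''} → S''`,
together with a global section `α̃` of `R^{2k}π''_*ℚ`, whose restriction to `X_0` is equal to `α`",
Voisin 2007, §3): under the hypotheses of `forall_transportFun_familyPullback_eq`, with `S'(ℂ)` path
connected and locally path connected, `α'` extends to a CONTINUOUS global section of the espace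
étalé of `Rᵏ π'_* ℂ` through `(s', α')` — the input shape of the tree's
`deligne_globalInvariantCycles` (Voisin II, Lemma 4.17, the tree's
`exists_continuous_section_of_forall_transportFun_eq`).
[cite: Voisin2007HodgeLoci, §3, proof of Prop. 0.7 (arXiv Prop. 1.7, p. 7)]
[cite: VoisinHodgeII2003, Lemma 4.17] -/
theorem exists_continuous_section_familyPullback [IsSeparated S.hom]
    (hg : IsLocalHomeomorph
      (Motives.AlgPoints.map g : Motives.ComplexPoints S' → Motives.ComplexPoints S))
    (hU : IsCohomologicallyLocallyTrivialOn π (Set.univ : Set (Motives.ComplexPoints S)))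
    (hU' : IsCohomologicallyLocallyTrivialOn (Motives.familyPullback.snd π g)
      (Set.univ : Set (Motives.ComplexPoints S')))
    [PathConnectedSpace (Motives.ComplexPoints S')]
    [LocallyPathConnectedSpace (Motives.ComplexPoints S')]
    (s' : Motives.ComplexPoints S')
    (α' : complexBetti (Motives.fiberOver (Motives.familyPullback.snd π g) s') k)
    {α : complexBetti (Motives.fiberOver π (Motives.AlgPoints.map g s')) k}
    (hα : (FiberClass.baseChange π g k ⟨s', α'⟩).cls = α)
    (hinv : ∀ γ' : Path (⟨s', Set.mem_univ s'⟩ : (Set.univ : Set (Motives.ComplexPoints S')))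
        ⟨s', Set.mem_univ s'⟩,
      transportFun π k hU
          (s := ⟨Motives.AlgPoints.map g s', Set.mem_univ _⟩)
          (t := ⟨Motives.AlgPoints.map g s', Set.mem_univ _⟩)
          ⟦γ'.map ((((Motives.AlgPoints.continuous_map g).comp continuous_subtype_val)).subtype_mk
            fun _ ↦ Set.mem_univ _)⟧ α = α) :
    ∃ σ' : Motives.ComplexPoints S' → FiberClass (Motives.familyPullback.snd π g) k,
      Continuous σ' ∧ (∀ t, (σ' t).pt = t) ∧ σ' s' = ⟨s', α'⟩ :=
  exists_continuous_section_of_forall_transportFun_eq _ k hU' s' α'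
    (forall_transportFun_familyPullback_eq π g k hg hU hU' s' α' hα hinv)

/-- The transfer of `(s', e^* α)` is `(g s', α)`, `e : X'_{s'} ≅ X_{g s'}` the fibre isomorphism
(`e⁻¹* e^* = id`). [folklore] -/
theorem FiberClass.cls_baseChange_map_hom (s' : Motives.ComplexPoints S')
    (α : complexBetti (Motives.fiberOver π (Motives.AlgPoints.map g s')) k) :
    (FiberClass.baseChange π g k
        ⟨s', complexBetti.map (Motives.fiberOverFamilyPullbackIso π g s').hom k α⟩).cls = α := by
  rw [FiberClass.cls_baseChange]
  change complexBetti.map (Motives.fiberOverFamilyPullbackIso π g s').inv k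
    (complexBetti.map (Motives.fiberOverFamilyPullbackIso π g s').hom k α) = α
  rw [← ModuleCat.comp_apply, ← complexBetti.map_comp, Iso.inv_hom_id, complexBetti.map_id]
  rfl

end EtaleCover

/-! ### The fact from its classical inputs (Voisin 2007, §3, proof of Prop. 0.7 — assembled) -/

section Assembly

/-- **`voisin2007_algebraic_of_finite_monodromyOrbit_of_qbar` from its classical inputs.** The
last paragraph of Voisin's proof of Prop. 0.7 (arXiv Prop. 1.7), *"As monodromy acts in a finite
way on the set of Hodge classes …, there is an étale cover `S''` of the smooth part of `S'`, also
defined over `ℚ̄`, on which this monodromy action becomes trivial. Thus we have by base change a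
family `π'' : 𝒳_{S''} → S''`, together with a global section `α̃` of `R^{2k}π''_*ℚ`, whose
restriction to `X_0` is equal to `α`. The global invariant cycle theorem now says that there exists
a Hodge class `β` on a smooth compactification `𝒳̄_{S''}`, which we may assume defined over `ℚ̄`,
restricting to `α`. If the Hodge conjecture is true for Hodge classes on varieties defined over
`ℚ̄`, it is then true for `β` and thus also for `α`"*, PROVED on the tree's real carriers from five
inputs, each a published theorem stated in the shape consumed (HYPOTHESES; `hD` and `hpol` are named
facts of the tree, the other three have no declaration in the tree and this theorem introduces none):

* `hRE` — **Riemann's existence theorem with descent to `ℚ̄`** (SGA1 XII Thm. 5.1: a finite-index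
  subgroup `H` of `π₁(S(ℂ), s)`, `S = S₀ ⊗_σ ℂ` a smooth irreducible quasi-projective variety, is
  realised by a connected finite étale cover of `S`; SGA1 XIII Prop. 4.6 / X Cor. 1.8: finite étale
  covers of `S₀ ⊗_σ ℂ` come from finite étale covers of `S₀`, `ℚ̄` being algebraically closed of
  characteristic `0`): an étale `g₀ : S₀' ⟶ S₀` over `ℚ̄` with `S₀'` quasi-projective and
  `S₀' ⊗_σ ℂ` irreducible, a complex point `s'` over `s`, such that every loop at `s'` maps into `H`;
* `hComp` — **a smooth projective compactification DEFINED OVER `ℚ̄` of the base-changed family**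
  `𝒳 ×_S S' = (𝒳₀ ×_{S₀} S₀') ⊗_σ ℚ̄` (Nagata's compactification and Hironaka's Main Theorem I
  over `ℚ̄`, applied to the smooth quasi-projective irreducible `ℚ̄`-scheme `𝒳₀ ×_{S₀} S₀'`; base
  change commutes with fibre products) — Voisin's *"which we may assume defined over `ℚ̄`"*;
* `hD` — Deligne's global invariant cycle theorem (*Hodge II*, Thm. 4.1.1), the tree's named fact
  `deligne_globalInvariantCycles`;
* `hpol` — the polarisability of the Hodge structure on the rational cohomology of a smooth
  projective variety (Hodge–Riemann), the tree's named fact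
  `smoothProjective_hodgeStructure_isPolarizable`, feeding the tree's PROVED Hodge lift
  `deligne_globalInvariantCycles.exists_hodgeClass_eq_globalSection_of_exists_isReal_hodgeModel`
  (with the discharged `exists_isReal_hodgeModel_holds`, `hodgePQ_independent_of_hodgeModel_holds`);
* `hPull` — **pull-back of algebraic classes along a morphism of smooth projective complex
  varieties is algebraic** (Fulton 1998, Cor. 19.2 (b): "`cl : A^*X → H^*X` is a homomorphism of
  graded rings, contravariant for morphisms of non-singular varieties", with `Nᵖ H²ᵖ` = the span of
  cycle classes, Lemma 19.1.1), applied to `X'_{s'} ⟶ 𝒳̄`.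

Assembly (everything else is proved in the tree): the finite orbit is a finite-index stabiliser
(`exists_finiteIndex_of_finite_setOf_isContinuationAlong_of_qbarFamily`); on the cover the
transferred class `α' = e^* α` (`e : X'_{s'} ≅ X_{g s'}`) is monodromy invariant and extends to a
continuous global section (`exists_continuous_section_familyPullback`: transport commutes with the
étale base change, `FiberClass.baseChange_transportFun`, `g(ℂ)` being a local homeomorphism,
`Motives.ComplexPoints.isLocalHomeomorph_map`; Voisin II Lemma 4.17,
`exists_continuous_section_of_forall_transportFun_eq`; `R^k f'_* ℂ` is a local system by Ehresmann,
`isCohomologicallyLocallyTrivialOn_univ_of_isSmoothProjectiveFamily`, and `S'(ℂ)` is a connected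
manifold, SGA1 XII 2.4 `Motives.ComplexPoints.connectedSpace_iff_holds`); the global invariant cycle
theorem with the Hodge lift gives a rational `(p,p)` class `β` on `𝒳̄ = 𝒳̄₀ ⊗_σ ℂ` with
`β|_{X'_{s'}} = α'`; the hypothesis of the fact (the Hodge conjecture for `𝒳̄₀ ⊗_σ ℂ`) makes `β`
algebraic, `hPull` makes `α' = (X'_{s'} → 𝒳̄)^* β` algebraic, and algebraic classes transport along
`e` (`mem_algebraicClasses_map_iff_of_iso`).
[cite: Voisin2007HodgeLoci, §3, proof of Prop. 0.7 (arXiv math/0605766 Prop. 1.7, p. 7)]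
[cite: CharlesSchnell2014Notes, Thm. 11.3.19 (proof) and Prop. 11.3.5 (proof)]
[cite: SGA1, Exp. XII Thm. 5.1 and Exp. XIII Prop. 4.6] [cite: DeligneHodgeII1971, Théorème 4.1.1]
[cite: Fulton1998, Cor. 19.2 (b) and Lemma 19.1.1] [cite: Hironaka1964, Main Theorem I] -/
theorem voisin2007_algebraic_of_finite_monodromyOrbit_of_qbar_of_classical_inputs
    (hRE : ∀ (σ : AlgebraicClosure ℚ →+* ℂ) (S₀ : Motives.SchemeOver (AlgebraicClosure ℚ)),
      IsQuasiProjectiveOver S₀ → IrreducibleSpace S₀.left → AlgebraicGeometry.Smooth S₀.hom →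
      ∀ (s : Motives.ComplexPoints ((Motives.baseChangeHom σ).obj S₀))
        (H : Subgroup (FundamentalGroup
          (Set.univ : Set (Motives.ComplexPoints ((Motives.baseChangeHom σ).obj S₀)))
            ⟨s, Set.mem_univ s⟩)), H.FiniteIndex →
        ∃ (S₀' : Motives.SchemeOver (AlgebraicClosure ℚ)) (g₀ : S₀' ⟶ S₀)
          (s' : Motives.ComplexPoints ((Motives.baseChangeHom σ).obj S₀'))
          (hs : Motives.AlgPoints.map ((Motives.baseChangeHom σ).map g₀) s' = s),
          IsQuasiProjectiveOver S₀' ∧ IrreducibleSpace ((Motives.baseChangeHom σ).obj S₀').left ∧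
          AlgebraicGeometry.Etale g₀.left ∧
          ∀ γ' : Path (⟨s', Set.mem_univ s'⟩ :
              (Set.univ : Set (Motives.ComplexPoints ((Motives.baseChangeHom σ).obj S₀'))))
              ⟨s', Set.mem_univ s'⟩,
            FundamentalGroup.fromPath
              (⟦(γ'.map ((((Motives.AlgPoints.continuous_map ((Motives.baseChangeHom σ).map g₀)).comp
                  continuous_subtype_val)).subtype_mk fun _ ↦ Set.mem_univ _)).cast
                (Subtype.ext hs.symm) (Subtype.ext hs.symm)⟧) ∈ H)
    (hComp : ∀ (σ : AlgebraicClosure ℚ →+* ℂ) ⦃𝒳₀ S₀ S₀' : Motives.SchemeOver (AlgebraicClosure ℚ)⦄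
      (f₀ : 𝒳₀ ⟶ S₀) (g₀ : S₀' ⟶ S₀) (n : ℕ),
      IsQuasiProjectiveOver 𝒳₀ → IsQuasiProjectiveOver S₀ → IsQuasiProjectiveOver S₀' →
      IrreducibleSpace S₀.left → AlgebraicGeometry.Smooth S₀.hom → AlgebraicGeometry.Etale g₀.left →
      IrreducibleSpace ((Motives.baseChangeHom σ).obj S₀').left →
      Motives.IsSmoothProjectiveFamily ((Motives.baseChangeHom σ).map f₀) n →
      ∃ (m : ℕ) (Xbar₀ : Motives.SchemeOver (AlgebraicClosure ℚ))
        (i : Motives.familyPullback ((Motives.baseChangeHom σ).map f₀)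
            ((Motives.baseChangeHom σ).map g₀) ⟶ (Motives.baseChangeHom σ).obj Xbar₀),
        Motives.IsSmoothProjective m ((Motives.baseChangeHom σ).obj Xbar₀) ∧ IsOpenImmersion i.left)
    (hD : deligne_globalInvariantCycles) (hpol : smoothProjective_hodgeStructure_isPolarizable)
    (hPull : ∀ ⦃m n : ℕ⦄ ⦃Y X : Motives.SchemeOver ℂ⦄ (j : X ⟶ Y),
      Motives.IsSmoothProjective m Y → Motives.IsSmoothProjective n X →
      ∀ (p : ℕ), ∀ β ∈ algebraicClasses Y p, complexBetti.map j (2 * p) β ∈ algebraicClasses X p) :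
    voisin2007_algebraic_of_finite_monodromyOrbit_of_qbar := by
  unfold voisin2007_algebraic_of_finite_monodromyOrbit_of_qbar
  intro σ 𝒳₀ S₀ f₀ n p h𝒳₀ hS₀ hirr hsm hf s α hαr hαh hfin hHC
  haveI := hirr
  -- Step 1 (the orbit): finite orbit ⟹ a finite-index subgroup `H ≤ π₁(S(ℂ), s)` fixes `α`
  obtain ⟨hU, H, hHfi, hHfix⟩ :=
    exists_finiteIndex_of_finite_setOf_isContinuationAlong_of_qbarFamily σ f₀ (2 * p) hS₀ hsm hf
      s α hfin
  -- Step 2 (the étale cover `S'' → S`, defined over `ℚ̄`): Riemann existence + descent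
  obtain ⟨S₀', g₀, s', hs, hS₀'qp, hS'irr, hg₀, hloops⟩ := hRE σ S₀ hS₀ hirr hsm s H hHfi
  subst hs
  -- Step 3: the bases `S = S₀ ⊗ ℂ`, `S' = S₀' ⊗ ℂ` are smooth of the same pure dimension `d`,
  -- quasi-projective; `S'(ℂ)` is a connected manifold; `g(ℂ)` is a local homeomorphism
  haveI := hsm
  obtain ⟨d, hd⟩ := Motives.exists_smoothOfRelativeDimension_of_smooth S₀.hom
  haveI := hd
  haveI hSd : SmoothOfRelativeDimension d ((Motives.baseChangeHom σ).obj S₀).hom :=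
    smoothOfRelativeDimension_baseChangeHom_hom σ d S₀
  have hSqp : IsQuasiProjectiveOver ((Motives.baseChangeHom σ).obj S₀) := hS₀.baseChangeHom σ
  have hS'qp : IsQuasiProjectiveOver ((Motives.baseChangeHom σ).obj S₀') := hS₀'qp.baseChangeHom σ
  haveI : LocallyOfFiniteType ((Motives.baseChangeHom σ).obj S₀).hom := hSqp.locallyOfFiniteType
  haveI : LocallyOfFiniteType ((Motives.baseChangeHom σ).obj S₀').hom := hS'qp.locallyOfFiniteType
  haveI : IsSeparated ((Motives.baseChangeHom σ).obj S₀).hom := hSqp.isVarietyPair_ofScheme.isSeparated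
  haveI := hg₀
  haveI hg0 : SmoothOfRelativeDimension 0 ((Motives.baseChangeHom σ).map g₀).left := by
    letI := σ.toAlgebra
    have := smoothOfRelativeDimension_isStableUnderBaseChange 0
    exact MorphismProperty.of_isPullback (P := @SmoothOfRelativeDimension 0)
      (Motives.isPullback_baseChange_map_left ℂ g₀).flip inferInstance
  haveI : AlgebraicGeometry.Smooth ((Motives.baseChangeHom σ).map g₀).left :=
    SmoothOfRelativeDimension.smooth 0 _
  haveI hS'd : SmoothOfRelativeDimension d ((Motives.baseChangeHom σ).obj S₀').hom := by
    have h : SmoothOfRelativeDimension (0 + d)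
        (((Motives.baseChangeHom σ).map g₀).left ≫ ((Motives.baseChangeHom σ).obj S₀).hom) :=
      inferInstance
    rw [Over.w] at h
    simpa using h
  haveI : IrreducibleSpace ((Motives.baseChangeHom σ).obj S₀').left := hS'irr
  haveI : ConnectedSpace (Motives.ComplexPoints ((Motives.baseChangeHom σ).obj S₀')) :=
    (Motives.ComplexPoints.connectedSpace_iff_holds _).2 inferInstance
  haveI : PathConnectedSpace (Motives.ComplexPoints ((Motives.baseChangeHom σ).obj S₀')) :=
    pathConnectedSpace_complexPoints_of_smoothOfRelativeDimension _ d
  letI := Motives.ComplexPoints.chartedSpace ((Motives.baseChangeHom σ).obj S₀') d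
  haveI : LocallyPathConnectedSpace (Motives.ComplexPoints ((Motives.baseChangeHom σ).obj S₀')) :=
    ChartedSpace.locallyPathConnectedSpace (EuclideanSpace ℝ (Fin (2 * d))) _
  have hgloc : IsLocalHomeomorph (Motives.AlgPoints.map ((Motives.baseChangeHom σ).map g₀) :
      Motives.ComplexPoints ((Motives.baseChangeHom σ).obj S₀') →
        Motives.ComplexPoints ((Motives.baseChangeHom σ).obj S₀)) :=
    Motives.ComplexPoints.isLocalHomeomorph_map d _
  -- Step 4 (base change of the family): `f' : 𝒳 ×_S S' ⟶ S'` is smooth projective, `R^{2p} f'_* ℂ`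
  -- is a local system, and `α' = e^* α` is monodromy invariant, hence a continuous global section
  have hf' := hf.familyPullback_snd ((Motives.baseChangeHom σ).map g₀)
  have hU' := isCohomologicallyLocallyTrivialOn_univ_of_isSmoothProjectiveFamily
    (Motives.familyPullback.snd ((Motives.baseChangeHom σ).map f₀) ((Motives.baseChangeHom σ).map g₀))
    d hf' hS'qp
  set e := Motives.fiberOverFamilyPullbackIso ((Motives.baseChangeHom σ).map f₀)
    ((Motives.baseChangeHom σ).map g₀) s' with he
  have hinv : ∀ γ' : Path (⟨s', Set.mem_univ s'⟩ :
      (Set.univ : Set (Motives.ComplexPoints ((Motives.baseChangeHom σ).obj S₀')))) ⟨s', Set.mem_univ s'⟩,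
      transportFun ((Motives.baseChangeHom σ).map f₀) (2 * p) hU
        (s := ⟨Motives.AlgPoints.map ((Motives.baseChangeHom σ).map g₀) s', Set.mem_univ _⟩)
        (t := ⟨Motives.AlgPoints.map ((Motives.baseChangeHom σ).map g₀) s', Set.mem_univ _⟩)
        ⟦γ'.map ((((Motives.AlgPoints.continuous_map ((Motives.baseChangeHom σ).map g₀)).comp
          continuous_subtype_val)).subtype_mk fun _ ↦ Set.mem_univ _)⟧ α = α :=
    fun γ' ↦ hHfix _ (hloops γ')
  obtain ⟨σ', hσ'c, hσ'pt, hσ'₀⟩ := exists_continuous_section_familyPullback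
    ((Motives.baseChangeHom σ).map f₀) ((Motives.baseChangeHom σ).map g₀) (2 * p) hgloc hU hU' s'
    (complexBetti.map e.hom (2 * p) α) (FiberClass.cls_baseChange_map_hom _ _ _ s' α) hinv
  have h₀ : σ' s' ∈ locusOfHodgeClasses
      (Motives.familyPullback.snd ((Motives.baseChangeHom σ).map f₀) ((Motives.baseChangeHom σ).map g₀))
      n p := by
    rw [hσ'₀]
    exact ⟨hαr.map _, hαh.map_of_iso e⟩
  -- Step 5 (global invariant cycles + Hodge lift on a smooth compactification defined over `ℚ̄`)
  obtain ⟨m, Xbar₀, i, hXbar, hi⟩ := hComp σ f₀ g₀ n h𝒳₀ hS₀ hS₀'qp hirr hsm hg₀ hS'irr hf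
  haveI := hi
  obtain ⟨β, hβr, hβh, hβσ⟩ :=
    hD.exists_hodgeClass_eq_globalSection_of_exists_isReal_hodgeModel exists_isReal_hodgeModel_holds
      hodgePQ_independent_of_hodgeModel_holds hpol _ i hf' hS'qp (SmoothOfRelativeDimension.smooth d _)
      hXbar hi hσ'c hσ'pt h₀
  -- Step 6 (the Hodge conjecture over `ℚ̄`, then restriction): `β` is algebraic, hence so is
  -- `α' = (X'_{s'} → 𝒳̄)^* β`, hence so is `α`
  have hβalg : β ∈ algebraicClasses ((Motives.baseChangeHom σ).obj Xbar₀) p := hHC hXbar p β hβr hβh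
  have hα'alg := hPull (Motives.fiberι (Motives.familyPullback.snd ((Motives.baseChangeHom σ).map f₀)
    ((Motives.baseChangeHom σ).map g₀)) s' ≫ i) hXbar (hf'.isSmoothProjective s') p β hβalg
  have hα'eq : complexBetti.map e.hom (2 * p) α =
      complexBetti.map (Motives.fiberι (Motives.familyPullback.snd ((Motives.baseChangeHom σ).map f₀)
        ((Motives.baseChangeHom σ).map g₀)) s' ≫ i) (2 * p) β := by
    have h1 := hσ'₀.symm.trans hβσ
    rw [(FiberClass.mk_eq_mk_iff _ _).1 h1, complexBetti.map_comp, ModuleCat.comp_apply]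
  rw [← hα'eq] at hα'alg
  exact (mem_algebraicClasses_map_iff_of_iso e).1 hα'alg

end Assembly

/-! ### Proof of `lang1958_isDefinedOverQbar_descends` (Lang 1958, III §2 Thm. 7 and III §5, C4 ⇒ C7)

The printed proof (Lang, *Introduction to Algebraic Geometry*, Ch. III): an automorphism-stable ideal
of `Ω[X]` has its smallest field of definition fixed by `Aut(Ω/k)` (§2, Thm. 7), hence contained in
`k` (the fixed field of `Aut(Ω/k)` is the perfect closure of `k`; here `char = 0`), so the closed set
is cut out by equations over `k` (§5, C5 ⇒ C6 ⇒ C7).  The formalization below follows the same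
mechanism on the tree's carriers (`Ω = ℂ`, `k = ℚ̄` embedded by `σ`, `S = S₀ ×_{ℚ̄} Spec ℂ`):
* the fixed field of `Aut(ℂ/ℚ̄)` is `ℚ̄` (`mem_range_algebraMap_of_forall_algEquiv`, via transcendence
  bases and uniqueness of algebraic closures);
* Thm. 7 in the form: an `Aut(C/K)`-stable ideal of `C ⊗[K] R` is generated by its `R`-part
  (`ideal_eq_map_comap_includeRight_of_stable`; minimal-support argument on coordinates,
  `mem_span_fixedCoord_of_stable`, in place of Lang's monomial basis modulo the ideal);
* C4 ⇒ C7 on an affine chart `Spec (C ⊗[K] R) ⟶ Spec R`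
  (`exists_isClosed_preimage_comap_includeRight_eq`) and glued over an affine open cover of `S₀`
  (`exists_isClosed_preimage_fst_eq_of_stable`); no finite-type hypothesis is needed;
* identification of the tree's `conjPoint` action on `S(ℂ)` with the scheme automorphisms
  `𝟙 ×_K Spec τ⁻¹` of `S₀ ×_K Spec ℂ` (`pt_conjPoint_eq`).
-/

universe u v

section FixedField

variable {K : Type u} {C : Type v} [Field K] [Field C] [Algebra K C]

/-- An element of `C` which is integral over an algebraically closed subfield `K` lies in `K`
(its minimal polynomial splits in `K`). [folklore] -/
theorem mem_range_algebraMap_of_isIntegral_of_isAlgClosed [IsAlgClosed K] {c : C}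
    (hc : IsIntegral K c) : c ∈ Set.range (algebraMap K C) := by
  have h := hc.mem_range_algebraMap_of_minpoly_splits (K := K) (IsAlgClosed.splits _)
  exact RingHom.mem_range.mp h

/-- The `K`-algebra automorphism of `MvPolynomial ι K` shifting one variable by `1` (and fixing the
others) exists. [folklore] -/
theorem exists_algEquiv_mvPolynomial_X_add_one (ι : Type*) [DecidableEq ι] (i₀ : ι) :
    ∃ ν : MvPolynomial ι K ≃ₐ[K] MvPolynomial ι K, ν (MvPolynomial.X i₀) = MvPolynomial.X i₀ + 1 := by
  classical
  let v : ι → MvPolynomial ι K := fun j => if j = i₀ then MvPolynomial.X j + 1 else MvPolynomial.X j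
  let v' : ι → MvPolynomial ι K := fun j => if j = i₀ then MvPolynomial.X j - 1 else MvPolynomial.X j
  have h1 : (MvPolynomial.aeval v).comp (MvPolynomial.aeval v') = AlgHom.id K _ := by
    refine MvPolynomial.algHom_ext fun j => ?_
    by_cases hj : j = i₀
    · subst hj
      simp [v, v']
    · simp [v, v', hj]
  have h2 : (MvPolynomial.aeval v').comp (MvPolynomial.aeval v) = AlgHom.id K _ := by
    refine MvPolynomial.algHom_ext fun j => ?_
    by_cases hj : j = i₀
    · subst hj
      simp [v, v']
    · simp [v, v', hj]
  refine ⟨AlgEquiv.ofAlgHom (MvPolynomial.aeval v) (MvPolynomial.aeval v') h1 h2, ?_⟩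
  simp [v]

/-- **Fixed field of `Aut(C/K)`.** For `K ⊆ C` both algebraically closed, an element of `C` fixed
by every `K`-algebra automorphism of `C` lies in `K`: a transcendental `c` is part of a
transcendence basis, and the automorphism `c ↦ c + 1` of the purely transcendental subalgebra extends
to `C` (uniqueness of algebraic closures).  This is the characteristic-`0` / algebraically-closed-`K`
case of "the fixed field of `Aut(Ω/k)` is the perfect closure of `k`" used in Lang, *Introduction to
Algebraic Geometry*, III §5, C5 ⇒ C6. [folklore] -/
theorem mem_range_algebraMap_of_forall_algEquiv [IsAlgClosed K] [IsAlgClosed C] {c : C}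
    (hc : ∀ τ : C ≃ₐ[K] C, τ c = c) : c ∈ Set.range (algebraMap K C) := by
  classical
  by_contra hnot
  have ht : Transcendental K c := fun halg =>
    hnot (mem_range_algebraMap_of_isIntegral_of_isAlgClosed halg.isIntegral)
  -- extend `{c}` to a transcendence basis
  have hind : AlgebraicIndepOn K id ({c} : Set C) := by
    rw [AlgebraicIndepOn, algebraicIndependent_singleton_iff (⟨c, Set.mem_singleton c⟩ : ({c} : Set C))]
    exact ht
  obtain ⟨t, hct, hbasis⟩ := exists_isTranscendenceBasis_superset hind
  have hc_mem : c ∈ t := hct (Set.mem_singleton c)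
  set x : t → C := Subtype.val with hx
  let i₀ : t := ⟨c, hc_mem⟩
  obtain ⟨ν, hν⟩ := exists_algEquiv_mvPolynomial_X_add_one (K := K) t i₀
  let F := Algebra.adjoin K (Set.range x)
  haveI : IsAlgClosure F C := IsAlgClosed.isAlgClosure_of_transcendence_basis x hbasis
  let e : F ≃ₐ[K] F := hbasis.1.aevalEquiv.symm.trans (ν.trans hbasis.1.aevalEquiv)
  let τ₀ : C ≃+* C := IsAlgClosure.equivOfEquiv C C e.toRingEquiv
  have hτ₀ : ∀ s : F, τ₀ (algebraMap F C s) = algebraMap F C (e s) := fun s =>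
    IsAlgClosure.equivOfEquiv_algebraMap C C e.toRingEquiv s
  have hcomm : ∀ a : K, τ₀ (algebraMap K C a) = algebraMap K C a := by
    intro a
    rw [IsScalarTower.algebraMap_apply K F C a, hτ₀, AlgEquiv.commutes]
  let τ : C ≃ₐ[K] C := AlgEquiv.ofRingEquiv (f := τ₀) hcomm
  have hcF : algebraMap F C (hbasis.1.aevalEquiv (MvPolynomial.X i₀)) = c := by
    rw [AlgebraicIndependent.algebraMap_aevalEquiv, MvPolynomial.aeval_X]
  have hτc : τ c = c + 1 := by
    change τ₀ c = c + 1
    conv_lhs => rw [← hcF]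
    rw [hτ₀]
    simp only [e, AlgEquiv.trans_apply, AlgEquiv.symm_apply_apply, hν, map_add, map_one]
    rw [AlgebraicIndependent.algebraMap_aevalEquiv, MvPolynomial.aeval_X]
  have := hc τ
  rw [hτc] at this
  simp at this

end FixedField

universe w

section LinearDescent

variable {K : Type u} {C : Type v} [Field K] [Field C] [Algebra K C] {ι : Type w}

/-- **Galois-stable subspaces are defined over the fixed field** (Lang, *Introduction to Algebraic
Geometry*, III §2, Thm. 7, the mechanism: minimal relations have coefficients in the fixed field).
If every element of `C` fixed by all `K`-automorphisms of `C` lies in `K`, then a `C`-subspace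
`V ⊆ C^{(ι)}` stable under the coordinatewise action of `Aut(C/K)` is spanned by its vectors with
coordinates in `K`. Proof by induction on the size of the support, extracting a vector of minimal
support (which, normalised, has coordinates in `K`). [cite: Lang1958IAG, Ch. III §2, Thm. 7] -/
theorem mem_span_fixedCoord_of_stable
    (hfix : ∀ c : C, (∀ τ : C ≃ₐ[K] C, τ c = c) → c ∈ Set.range (algebraMap K C))
    (V : Submodule C (ι →₀ C))
    (hV : ∀ τ : C ≃ₐ[K] C, ∀ v ∈ V, Finsupp.mapRange τ (map_zero τ) v ∈ V) :
    ∀ v ∈ V, v ∈ Submodule.span C {u | u ∈ V ∧ ∀ i, u i ∈ Set.range (algebraMap K C)} := by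
  classical
  -- strong induction on the cardinality of the support
  suffices h : ∀ n : ℕ, ∀ v ∈ V, v.support.card = n →
      v ∈ Submodule.span C {u | u ∈ V ∧ ∀ i, u i ∈ Set.range (algebraMap K C)} from
    fun v hv => h _ v hv rfl
  intro n
  induction n using Nat.strong_induction_on with
  | _ n ih =>
  intro v hv hcard
  by_cases hv0 : v = 0
  · subst hv0; exact Submodule.zero_mem _
  -- vectors of `V` with support inside `supp v`, of minimal support size
  have hex : ∃ m : ℕ, ∃ w ∈ V, w ≠ 0 ∧ w.support ⊆ v.support ∧ w.support.card = m :=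
    ⟨_, v, hv, hv0, subset_rfl, rfl⟩
  obtain ⟨w, hwV, hw0, hwsupp, hwcard⟩ := Nat.find_spec hex
  have hmin : ∀ w' ∈ V, w' ≠ 0 → w'.support ⊆ v.support → Nat.find hex ≤ w'.support.card :=
    fun w' h1 h2 h3 => Nat.find_min' hex ⟨w', h1, h2, h3, rfl⟩
  -- normalise `w` at some index `j` of its support
  obtain ⟨j, hj⟩ : w.support.Nonempty := Finsupp.support_nonempty_iff.mpr hw0
  have hwj : w j ≠ 0 := Finsupp.mem_support_iff.mp hj
  set w₁ : ι →₀ C := (w j)⁻¹ • w with hw₁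
  have hw₁V : w₁ ∈ V := V.smul_mem _ hwV
  have hw₁j : w₁ j = 1 := by simp [hw₁, hwj]
  have hw₁supp : w₁.support = w.support := by
    rw [hw₁, Finsupp.support_smul_eq (inv_ne_zero hwj)]
  -- `w₁` has coordinates in `K`: `τ w₁ - w₁` has smaller support, hence vanishes
  have hw₁K : ∀ i, w₁ i ∈ Set.range (algebraMap K C) := by
    intro i
    refine hfix _ fun τ => ?_
    set d : ι →₀ C := Finsupp.mapRange τ (map_zero τ) w₁ - w₁ with hd
    have hdV : d ∈ V := V.sub_mem (hV τ _ hw₁V) hw₁V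
    have hdsupp : d.support ⊆ w.support.erase j := by
      intro i hi
      rw [Finset.mem_erase]
      rw [Finsupp.mem_support_iff] at hi
      constructor
      · rintro rfl
        apply hi
        simp [hd, hw₁j]
      · rw [← hw₁supp, Finsupp.mem_support_iff]
        intro h0
        apply hi
        simp [hd, h0]
    have hd0 : d = 0 := by
      by_contra hd0
      have hle := hmin d hdV hd0 (hdsupp.trans ((Finset.erase_subset _ _).trans hwsupp))
      have hlt : d.support.card < w.support.card :=
        lt_of_le_of_lt (Finset.card_le_card hdsupp) (Finset.card_erase_lt_of_mem hj)
      rw [hwcard] at hlt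
      exact absurd hle (not_le.mpr hlt)
    have := DFunLike.congr_fun hd0 i
    simp only [hd, Finsupp.coe_sub, Pi.sub_apply, Finsupp.mapRange_apply, Finsupp.coe_zero,
      Pi.zero_apply, sub_eq_zero] at this
    exact this
  have hw₁span : w₁ ∈ Submodule.span C {u | u ∈ V ∧ ∀ i, u i ∈ Set.range (algebraMap K C)} :=
    Submodule.subset_span ⟨hw₁V, hw₁K⟩
  -- subtract to kill the `j`-th coordinate of `v` and apply induction
  set v' : ι →₀ C := v - v j • w₁ with hv'
  have hv'V : v' ∈ V := V.sub_mem hv (V.smul_mem _ hw₁V)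
  have hjv : j ∈ v.support := hwsupp hj
  have hv'supp : v'.support ⊆ v.support.erase j := by
    intro i hi
    rw [Finset.mem_erase]
    rw [Finsupp.mem_support_iff] at hi
    constructor
    · rintro rfl
      apply hi
      simp [hv', hw₁j]
    · rw [Finsupp.mem_support_iff]
      intro h0
      apply hi
      have : w₁ i = 0 := by
        rw [← Finsupp.notMem_support_iff, hw₁supp]
        intro hi'
        exact (Finsupp.mem_support_iff.mp (hwsupp hi')) h0
      simp [hv', h0, this]
  have hlt : v'.support.card < n := by
    rw [← hcard]
    exact lt_of_le_of_lt (Finset.card_le_card hv'supp) (Finset.card_erase_lt_of_mem hjv)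
  have hv'span := ih _ hlt v' hv'V rfl
  have : v = v' + v j • w₁ := by simp [hv']
  rw [this]
  exact Submodule.add_mem _ hv'span (Submodule.smul_mem _ _ hw₁span)

/-- A finitely supported function with values in the image of `K` comes from `K`. [folklore] -/
theorem exists_mapRange_eq_of_forall_mem_range {u : ι →₀ C}
    (hu : ∀ i, u i ∈ Set.range (algebraMap K C)) :
    ∃ u' : ι →₀ K, Finsupp.mapRange (algebraMap K C) (map_zero _) u' = u := by
  classical
  choose g hg using hu
  refine ⟨Finsupp.onFinset u.support g fun i hi => ?_, ?_⟩
  · rw [Finsupp.mem_support_iff]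
    intro h0
    apply hi
    apply (algebraMap K C).injective
    rw [hg, h0, map_zero]
  · ext i
    simp [hg]

end LinearDescent

section TensorDescent

open TensorProduct

variable {K : Type u} {C : Type u} [Field K] [Field C] [Algebra K C]
  {R : Type u} [CommRing R] [Algebra K R]

/-- Coordinates of the Galois twist `τ ⊗ id` on `C ⊗[K] R` in the basis `1 ⊗ bᵢ`: they are the
`τ`-conjugates of the coordinates. [folklore] -/
theorem basis_repr_map_algEquiv {ι : Type*} (b : Module.Basis ι K R) (τ : C ≃ₐ[K] C)
    (x : C ⊗[K] R) :
    (Algebra.TensorProduct.basis C b).repr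
        (Algebra.TensorProduct.map (τ : C →ₐ[K] C) (AlgHom.id K R) x) =
      Finsupp.mapRange τ (map_zero τ) ((Algebra.TensorProduct.basis C b).repr x) := by
  induction x using TensorProduct.induction_on with
  | zero => simp
  | tmul c r =>
    rw [Algebra.TensorProduct.map_tmul]
    simp only [AlgHom.coe_id, id_eq, Algebra.TensorProduct.basis_repr_tmul]
    ext i
    simp only [Finsupp.smul_apply, Finsupp.mapRange_apply, smul_eq_mul, map_mul,
      AlgEquiv.commutes]
    rfl
  | add x y hx hy =>
    rw [map_add, map_add, hx, hy, map_add, Finsupp.mapRange_add (by simp)]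

/-- **An `Aut(C/K)`-stable ideal of `C ⊗[K] R` is generated by elements of `R`** (Lang III §2,
Thm. 7: an automorphism-stable ideal has a basis in the fixed field), assuming the fixed field of
`Aut(C/K)` is `K`. [cite: Lang1958IAG, Ch. III §2, Thm. 7] -/
theorem ideal_eq_map_comap_includeRight_of_stable
    (hfix : ∀ c : C, (∀ τ : C ≃ₐ[K] C, τ c = c) → c ∈ Set.range (algebraMap K C))
    (J : Ideal (C ⊗[K] R))
    (hJ : ∀ τ : C ≃ₐ[K] C, ∀ x ∈ J,
      Algebra.TensorProduct.map (τ : C →ₐ[K] C) (AlgHom.id K R) x ∈ J) :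
    J = (J.comap (Algebra.TensorProduct.includeRight (R := K) (A := C) (B := R))).map
      (Algebra.TensorProduct.includeRight (R := K) (A := C) (B := R)) := by
  classical
  refine le_antisymm ?_ Ideal.map_comap_le
  intro x hx
  obtain ⟨ι, b⟩ := (Module.Free.exists_basis (R := K) (M := R))
  set B := Algebra.TensorProduct.basis C b with hB
  -- the coordinate subspace
  let V : Submodule C (ι →₀ C) :=
    (J.restrictScalars C).comap (B.repr.symm : (ι →₀ C) →ₗ[C] C ⊗[K] R)
  have hVmem : ∀ v, v ∈ V ↔ B.repr.symm v ∈ J := fun v => Iff.rfl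
  have hV : ∀ τ : C ≃ₐ[K] C, ∀ v ∈ V, Finsupp.mapRange τ (map_zero τ) v ∈ V := by
    intro τ v hv
    rw [hVmem] at hv ⊢
    have := basis_repr_map_algEquiv b τ (B.repr.symm v)
    rw [LinearEquiv.apply_symm_apply] at this
    rw [← this, LinearEquiv.symm_apply_apply]
    exact hJ τ _ hv
  have hxV : B.repr x ∈ V := by
    rw [hVmem, LinearEquiv.symm_apply_apply]; exact hx
  have hspan := mem_span_fixedCoord_of_stable hfix V hV _ hxV
  -- transport back along `B.repr.symm`
  have hx' : x ∈ Submodule.span C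
      ((B.repr.symm : (ι →₀ C) →ₗ[C] C ⊗[K] R) ''
        {u | u ∈ V ∧ ∀ i, u i ∈ Set.range (algebraMap K C)}) := by
    rw [Submodule.span_image]
    exact ⟨B.repr x, hspan, by simp⟩
  -- the target ideal, as a `C`-submodule
  let I : Ideal (C ⊗[K] R) :=
    (J.comap (Algebra.TensorProduct.includeRight (R := K) (A := C) (B := R))).map
      (Algebra.TensorProduct.includeRight (R := K) (A := C) (B := R))
  change x ∈ I.restrictScalars C
  refine (Submodule.span_le.mpr ?_) hx'
  rintro _ ⟨u, ⟨huV, huK⟩, rfl⟩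
  obtain ⟨u', rfl⟩ := exists_mapRange_eq_of_forall_mem_range huK
  -- `B.repr.symm (u' mapped) = 1 ⊗ r`
  set r : R := b.repr.symm u' with hr
  have hBr : B.repr ((1 : C) ⊗ₜ[K] r) = Finsupp.mapRange (algebraMap K C) (map_zero _) u' := by
    rw [hB, Algebra.TensorProduct.basis_repr_tmul, one_smul, hr, LinearEquiv.apply_symm_apply]
  have hsymm : B.repr.symm (Finsupp.mapRange (algebraMap K C) (map_zero _) u') = (1 : C) ⊗ₜ[K] r := by
    rw [← hBr, LinearEquiv.symm_apply_apply]
  change (B.repr.symm (Finsupp.mapRange (algebraMap K C) (map_zero _) u')) ∈ I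
  rw [hsymm]
  have hrJ : r ∈ J.comap (Algebra.TensorProduct.includeRight (R := K) (A := C) (B := R)) := by
    rw [Ideal.mem_comap, Algebra.TensorProduct.includeRight_apply, ← hsymm]
    exact (hVmem _).mp huV
  exact Ideal.mem_map_of_mem _ hrJ


/-- **Affine descent of Galois-stable closed sets** (Lang, *Introduction to Algebraic Geometry*,
III §5, C4 ⇒ C7, affine case): a closed subset of `Spec (C ⊗[K] R)` stable under the twists
`τ ⊗ id`, `τ ∈ Aut(C/K)`, is the preimage of a closed subset of `Spec R`, namely the zero locus of
the `R`-part of its vanishing ideal — provided the fixed field of `Aut(C/K)` is `K`.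
[cite: Lang1958IAG, Ch. III §5, C4–C7] -/
theorem exists_isClosed_preimage_comap_includeRight_eq
    (hfix : ∀ c : C, (∀ τ : C ≃ₐ[K] C, τ c = c) → c ∈ Set.range (algebraMap K C))
    (T : Set (PrimeSpectrum (C ⊗[K] R))) (hT : IsClosed T)
    (hstab : ∀ τ : C ≃ₐ[K] C, ∀ p ∈ T,
      PrimeSpectrum.comap
        (Algebra.TensorProduct.map (τ : C →ₐ[K] C) (AlgHom.id K R)).toRingHom p ∈ T) :
    ∃ W : Set (PrimeSpectrum R), IsClosed W ∧
      PrimeSpectrum.comap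
        (Algebra.TensorProduct.includeRight (R := K) (A := C) (B := R)).toRingHom ⁻¹' W = T := by
  set J := PrimeSpectrum.vanishingIdeal T with hJdef
  have hTJ : PrimeSpectrum.zeroLocus (J : Set (C ⊗[K] R)) = T := by
    rw [hJdef, PrimeSpectrum.zeroLocus_vanishingIdeal_eq_closure, hT.closure_eq]
  -- the vanishing ideal is stable under the twists
  have hJ : ∀ τ : C ≃ₐ[K] C, ∀ x ∈ J,
      Algebra.TensorProduct.map (τ : C →ₐ[K] C) (AlgHom.id K R) x ∈ J := by
    intro τ x hx
    rw [hJdef, PrimeSpectrum.mem_vanishingIdeal] at hx ⊢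
    intro p hp
    have := hx _ (hstab τ p hp)
    simpa [PrimeSpectrum.comap_asIdeal, Ideal.mem_comap] using this
  set incR := Algebra.TensorProduct.includeRight (R := K) (A := C) (B := R) with hincR
  have hJeq := ideal_eq_map_comap_includeRight_of_stable hfix J hJ
  refine ⟨PrimeSpectrum.zeroLocus (J.comap incR : Set R), PrimeSpectrum.isClosed_zeroLocus _, ?_⟩
  rw [← hTJ]
  ext p
  simp only [Set.mem_preimage, PrimeSpectrum.mem_zeroLocus, SetLike.coe_subset_coe,
    PrimeSpectrum.comap_asIdeal]
  constructor
  · intro h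
    rw [hJeq]
    exact Ideal.map_le_of_le_comap h
  · intro h
    exact Ideal.comap_mono h

end TensorDescent

section SchemeDescent

open CategoryTheory CategoryTheory.Limits _root_.AlgebraicGeometry
open scoped TensorProduct

variable {K : Type u} {C : Type u} [Field K] [Field C] [Algebra K C]

/-- **Chart step of the descent**: for a morphism `ι : Spec R ⟶ S₀` (an affine chart), a closed
subset `T ⊆ S₀ ×_K Spec C` stable under the Galois twists is, over the chart, the preimage of a
closed subset `W ⊆ Spec R` — obtained from the affine case on `Spec (C ⊗[K] R) ⟶ S₀ ×_K Spec C`.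
[cite: Lang1958IAG, Ch. III §5, C4–C7] -/
theorem exists_isClosed_chart_of_stable
    (hfix : ∀ c : C, (∀ τ : C ≃ₐ[K] C, τ c = c) → c ∈ Set.range (algebraMap K C))
    (S₀ : Over (Spec (CommRingCat.of K)))
    (T : Set ↥(pullback S₀.hom (Spec.map (CommRingCat.ofHom (algebraMap K C)))))
    (hT : IsClosed T)
    (hstab : ∀ τ : C ≃ₐ[K] C,
      ∃ ψ : pullback S₀.hom (Spec.map (CommRingCat.ofHom (algebraMap K C))) ⟶
          pullback S₀.hom (Spec.map (CommRingCat.ofHom (algebraMap K C))),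
        ψ ≫ pullback.fst _ _ = pullback.fst _ _ ∧
        ψ ≫ pullback.snd _ _ = pullback.snd _ _ ≫ Spec.map (CommRingCat.ofHom (τ : C →+* C)) ∧
        ∀ x ∈ T, ψ x ∈ T)
    {R : CommRingCat.{u}} (ι : Spec R ⟶ S₀.left) :
    ∃ W : Set ↥(Spec R), IsClosed W ∧
      ∀ (x : ↥(pullback S₀.hom (Spec.map (CommRingCat.ofHom (algebraMap K C))))) (y : ↥(Spec R)),
        pullback.fst S₀.hom (Spec.map (CommRingCat.ofHom (algebraMap K C))) x = ι y →
          (x ∈ T ↔ y ∈ W) := by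
  classical
  -- `R` is a `K`-algebra through `Spec R ⟶ S₀ ⟶ Spec K`
  letI : Algebra K R := (Spec.preimage (ι ≫ S₀.hom)).hom.toAlgebra
  have halg : Spec.map (CommRingCat.ofHom (algebraMap K R)) = ι ≫ S₀.hom := by
    rw [RingHom.algebraMap_toAlgebra, CommRingCat.ofHom_hom, Spec.map_preimage]
  set incL := Algebra.TensorProduct.includeLeftRingHom (R := K) (A := C) (B := R) with hincL
  set incR := (Algebra.TensorProduct.includeRight (R := K) (A := C) (B := R)).toRingHom with hincR
  -- the square `Spec (C ⊗ R) → Spec C`, `Spec R → Spec K` is cartesian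
  have s : IsPullback (Spec.map (CommRingCat.ofHom incL)) (Spec.map (CommRingCat.ofHom incR))
      (Spec.map (CommRingCat.ofHom (algebraMap K C))) (ι ≫ S₀.hom) := by
    rw [← halg]
    exact isPullback_SpecMap_of_isPushout _ _ _ _ (CommRingCat.isPushout_tensorProduct K C R)
  have t : IsPullback (pullback.snd S₀.hom (Spec.map (CommRingCat.ofHom (algebraMap K C))))
      (pullback.fst _ _) (Spec.map (CommRingCat.ofHom (algebraMap K C))) S₀.hom :=
    (IsPullback.of_hasPullback _ _).flip
  have sq := IsPullback.of_right' s t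
  set m := t.lift (Spec.map (CommRingCat.ofHom incL)) (Spec.map (CommRingCat.ofHom incR) ≫ ι)
    (by rw [s.w, Category.assoc]) with hm
  have hmsnd : m ≫ pullback.snd _ _ = Spec.map (CommRingCat.ofHom incL) := t.lift_fst _ _ _
  have hmfst : m ≫ pullback.fst _ _ = Spec.map (CommRingCat.ofHom incR) ≫ ι := t.lift_snd _ _ _
  -- the chart's closed set
  set TR : Set (PrimeSpectrum (C ⊗[K] R)) := {p | m p ∈ T} with hTR
  have hTRclosed : IsClosed TR := hT.preimage m.continuous
  have hTRstab : ∀ τ : C ≃ₐ[K] C, ∀ p ∈ TR,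
      PrimeSpectrum.comap
        (Algebra.TensorProduct.map (τ : C →ₐ[K] C) (AlgHom.id K R)).toRingHom p ∈ TR := by
    intro τ p hp
    obtain ⟨ψ, hψ1, hψ2, hψ3⟩ := hstab τ
    set θ := (Algebra.TensorProduct.map (τ : C →ₐ[K] C) (AlgHom.id K R)).toRingHom with hθ
    have hθR : θ.comp incR = incR := by
      ext r
      simp [hθ, hincR]
    have hθL : θ.comp incL = incL.comp (τ : C →+* C) := by
      ext c
      simp [hθ, hincL]
    have hcomm : Spec.map (CommRingCat.ofHom θ) ≫ m = m ≫ ψ := by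
      apply pullback.hom_ext
      · simp only [Category.assoc, hψ1]
        rw [hmfst, ← Spec.map_comp_assoc, ← CommRingCat.ofHom_comp, hθR]
      · simp only [Category.assoc, hψ2]
        rw [reassoc_of% hmsnd, hmsnd, ← Spec.map_comp, ← Spec.map_comp, ← CommRingCat.ofHom_comp,
          ← CommRingCat.ofHom_comp, hθL]
    change m (Spec.map (CommRingCat.ofHom θ) p) ∈ T
    rw [← Scheme.Hom.comp_apply, hcomm, Scheme.Hom.comp_apply]
    exact hψ3 _ hp
  obtain ⟨W, hW, hWT⟩ :=
    exists_isClosed_preimage_comap_includeRight_eq hfix TR hTRclosed hTRstab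
  refine ⟨W, hW, fun x y hxy => ?_⟩
  obtain ⟨p, rfl, rfl⟩ := Scheme.exists_preimage_of_isPullback sq x y hxy
  change p ∈ TR ↔ _
  rw [← hWT]
  rfl

/-- **Descent of Galois-stable closed sets along `S₀ ×_K Spec C ⟶ S₀`** (Lang, *Introduction
to Algebraic Geometry*, III §5, C4 ⇒ C7, on schemes): if the fixed field of `Aut(C/K)` is `K`,
a closed subset of `S₀ ×_K Spec C` stable under the twists `𝟙 × Spec τ` is the preimage of a
closed subset of `S₀`, namely its image. Glued from the affine charts (Lang treats abstract varieties
by representatives on affine charts, III §6 Prop. 13–14). [cite: Lang1958IAG, Ch. III §5, C4–C7] -/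
theorem exists_isClosed_preimage_fst_eq_of_stable
    (hfix : ∀ c : C, (∀ τ : C ≃ₐ[K] C, τ c = c) → c ∈ Set.range (algebraMap K C))
    (S₀ : Over (Spec (CommRingCat.of K)))
    (T : Set ↥(pullback S₀.hom (Spec.map (CommRingCat.ofHom (algebraMap K C)))))
    (hT : IsClosed T)
    (hstab : ∀ τ : C ≃ₐ[K] C,
      ∃ ψ : pullback S₀.hom (Spec.map (CommRingCat.ofHom (algebraMap K C))) ⟶
          pullback S₀.hom (Spec.map (CommRingCat.ofHom (algebraMap K C))),
        ψ ≫ pullback.fst _ _ = pullback.fst _ _ ∧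
        ψ ≫ pullback.snd _ _ = pullback.snd _ _ ≫ Spec.map (CommRingCat.ofHom (τ : C →+* C)) ∧
        ∀ x ∈ T, ψ x ∈ T) :
    ∃ W : Set ↥S₀.left, IsClosed W ∧
      (pullback.fst S₀.hom (Spec.map (CommRingCat.ofHom (algebraMap K C)))) ⁻¹' W = T := by
  classical
  set π := pullback.fst S₀.hom (Spec.map (CommRingCat.ofHom (algebraMap K C))) with hπ
  -- `π` is surjective (base change of `Spec C → Spec K`)
  have hsurj : ∀ w : ↥S₀.left, ∃ x, π x = w := by
    intro w
    obtain ⟨c⟩ : Nonempty ↥(Spec (CommRingCat.of C)) := inferInstance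
    have hwc : S₀.hom w = Spec.map (CommRingCat.ofHom (algebraMap K C)) c :=
      Subsingleton.elim (α := PrimeSpectrum K) _ _
    obtain ⟨x, hx, -⟩ := Scheme.Pullback.exists_preimage_pullback w c hwc
    exact ⟨x, hx⟩
  -- charts
  let 𝒰 := S₀.left.affineOpenCover
  choose W hW hWiff using fun j : 𝒰.I₀ =>
    exists_isClosed_chart_of_stable hfix S₀ T hT hstab (𝒰.f j)
  refine ⟨π '' T, ?_, ?_⟩
  · -- closedness: `(𝒰.f j) ⁻¹' (π '' T) = W j`, and the `𝒰.f j` are open maps covering `S₀`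
    have hpre : ∀ j, (𝒰.f j) ⁻¹' (π '' T) = W j := by
      intro j
      ext y
      constructor
      · rintro ⟨z, hz, hzy⟩
        exact (hWiff j z y hzy).mp hz
      · intro hy
        obtain ⟨x, hx⟩ := hsurj (𝒰.f j y)
        exact ⟨x, (hWiff j x y hx).mpr hy, hx⟩
    have hopen : IsOpen (π '' T)ᶜ := by
      have : (π '' T)ᶜ = ⋃ j, (𝒰.f j) '' (W j)ᶜ := by
        ext w
        simp only [Set.mem_compl_iff, Set.mem_iUnion, Set.mem_image]
        constructor
        · intro hw
          obtain ⟨y, hy⟩ := 𝒰.covers w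
          refine ⟨𝒰.idx w, y, ?_, hy⟩
          rw [← hpre, Set.mem_preimage, hy]
          exact hw
        · rintro ⟨j, y, hy, rfl⟩
          rw [← hpre] at hy
          exact hy
      rw [this]
      exact isOpen_iUnion fun j => (𝒰.f j).isOpenEmbedding.isOpenMap _ (hW j).isOpen_compl
    simpa using hopen.isClosed_compl
  · ext x
    constructor
    · rintro ⟨z, hz, hzx⟩
      obtain ⟨y, hy⟩ := 𝒰.covers (π z)
      have hyW : y ∈ W _ := (hWiff _ z y hy.symm).mp hz
      exact (hWiff _ x y (hy.trans hzx).symm).mpr hyW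
    · intro hx
      exact ⟨x, hx, rfl⟩

end SchemeDescent

section Glue

open CategoryTheory CategoryTheory.Limits _root_.AlgebraicGeometry
open Literature.AlgebraicGeometry.Motives

variable {k : Type} [Field k] (σ : k →+* ℂ) (S₀ : SchemeOver k)

/-- **The Galois action on `S(ℂ)` is induced by scheme automorphisms of `S = S₀ ×_k Spec ℂ`.**
For `τ ∈ Aut(ℂ/k)` and any endomorphism `ψ` of the `k`-scheme `S₀ ×_k Spec ℂ` over `S₀` covering
`Spec τ⁻¹` on the second factor (i.e. `ψ = 𝟙 ×_k Spec τ⁻¹`), the underlying point of the conjugate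
`τ · s` of a complex point `s` is `ψ` applied to the underlying point of `s`
(Lang III §4: `A^σ` is the set of points `(x^σ)`). [cite: Lang1958IAG, Ch. III §4] -/
theorem pt_conjPoint_eq (τ : ringAutOver σ) (s : ComplexPoints ((baseChangeHom σ).obj S₀))
    (ψ : pullback S₀.hom (Spec.map (CommRingCat.ofHom σ)) ⟶
      pullback S₀.hom (Spec.map (CommRingCat.ofHom σ)))
    (hψ1 : ψ ≫ pullback.fst _ _ = pullback.fst _ _)
    (hψ2 : ψ ≫ pullback.snd _ _ = pullback.snd _ _ ≫
      Spec.map (CommRingCat.ofHom (letI := σ.toAlgebra; ((τ.symm : ℂ ≃ₐ[k] ℂ) : ℂ →+* ℂ)))) :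
    (conjPoint σ S₀ τ s).pt = ψ s.pt := by
  letI := σ.toAlgebra
  -- the two `ℂ`-points, as morphisms into the fibre product with syntactically correct types
  set cl : Spec (.of ℂ) ⟶ pullback S₀.hom (Spec.map (CommRingCat.ofHom σ)) :=
    (conjPoint σ S₀ τ s).left with hcl
  set sl : Spec (.of ℂ) ⟶ pullback S₀.hom (Spec.map (CommRingCat.ofHom σ)) := s.left with hsl
  have h1 : cl ≫ pullback.snd _ _ = Spec.map (CommRingCat.ofHom (algebraMap ℂ ℂ)) :=
    Over.w (conjPoint σ S₀ τ s)
  have h2 : sl ≫ pullback.snd _ _ = Spec.map (CommRingCat.ofHom (algebraMap ℂ ℂ)) := Over.w s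
  have hc1 : cl ≫ pullback.fst _ _ = Spec.map (CommRingCat.ofHom (τ : ℂ →+* ℂ)) ≫ sl ≫ pullback.fst _ _ := by
    have e1 := AlgPoints.baseChangeEquiv_apply_left_comp_fst σ S₀
      (τ • (AlgPoints.baseChangeEquiv σ S₀).symm s)
    rw [AlgPoints.smul_left, AlgPoints.baseChangeEquiv_symm_apply_left] at e1
    exact e1
  have hτ : ((τ : ℂ ≃ₐ[k] ℂ) : ℂ →+* ℂ).comp ((τ.symm : ℂ ≃ₐ[k] ℂ) : ℂ →+* ℂ) = RingHom.id ℂ := by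
    ext c
    simp
  have key : cl = Spec.map (CommRingCat.ofHom (τ : ℂ →+* ℂ)) ≫ sl ≫ ψ := by
    apply pullback.hom_ext
    · rw [hc1]
      simp only [Category.assoc, hψ1]
    · rw [h1]
      simp only [Category.assoc, hψ2]
      rw [reassoc_of% h2]
      simp only [Algebra.algebraMap_self, CommRingCat.ofHom_id, Spec.map_id, Category.id_comp]
      rw [← Spec.map_comp, ← CommRingCat.ofHom_comp, hτ, CommRingCat.ofHom_id, Spec.map_id]
  change cl.base (IsLocalRing.closedPoint ℂ) = ψ.base (sl.base (IsLocalRing.closedPoint ℂ))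
  rw [key]
  simp only [Scheme.Hom.comp_base, TopCat.coe_comp, Function.comp_apply]
  congr 2
  exact Subsingleton.elim (α := PrimeSpectrum ℂ) _ _

end Glue

open CategoryTheory CategoryTheory.Limits _root_.AlgebraicGeometry Literature.AlgebraicGeometry.Motives in
/-- **Lang 1958, III §5, C4 ⇒ C7, for `k = ℚ̄ ⊆ ℂ`** — discharge of
`lang1958_isDefinedOverQbar_descends`: a subset of `S(ℂ)`, `S = S₀ ⊗_{ℚ̄,σ} ℂ`, which is Zariski
closed on points and stable under `Aut(ℂ/ℚ̄)` is the set of complex points over a Zariski-closed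
subset of `S₀`.  Proof: Lang's argument (III §2 Thm. 7 + III §5), see the section docstring above;
the quasi-projectivity hypothesis is not used. [cite: Lang1958IAG, Ch. III §5, C4–C7; Ch. III §2, Thm. 7] -/
theorem lang1958_isDefinedOverQbar_descends_holds : lang1958_isDefinedOverQbar_descends := by
  intro σ S₀ _ Z hZ
  letI : Algebra (AlgebraicClosure ℚ) ℂ := σ.toAlgebra
  obtain ⟨⟨Zc, hZc, hZeq⟩, hstabZ⟩ := hZ
  subst hZeq
  -- every `ℚ̄`-automorphism of `ℂ` fixes `algebraicClosure ℚ ℂ = σ(ℚ̄)` pointwise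
  have hall : ∀ τ : ℂ ≃ₐ[AlgebraicClosure ℚ] ℂ, ∀ z ∈ (algebraicClosure ℚ ℂ).toSubfield, τ z = z := by
    intro τ z hz
    rw [IntermediateField.mem_toSubfield, mem_algebraicClosure_iff'] at hz
    haveI : IsScalarTower ℚ (AlgebraicClosure ℚ) ℂ :=
      IsScalarTower.of_algebraMap_eq' (RingHom.ext_rat _ _)
    have hz' : IsIntegral (AlgebraicClosure ℚ) z := hz.tower_top
    obtain ⟨a, rfl⟩ := mem_range_algebraMap_of_isIntegral_of_isAlgClosed hz'
    exact τ.commutes a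
  have hfix : ∀ c : ℂ, (∀ τ : ℂ ≃ₐ[AlgebraicClosure ℚ] ℂ, τ c = c) →
      c ∈ Set.range (algebraMap (AlgebraicClosure ℚ) ℂ) :=
    fun c hc => mem_range_algebraMap_of_forall_algEquiv hc
  -- the Galois twists `𝟙 × Spec τ` of `S₀ ×_ℚ̄ Spec ℂ`
  have htwist : ∀ τ : ℂ ≃ₐ[AlgebraicClosure ℚ] ℂ,
      Spec.map (CommRingCat.ofHom (algebraMap (AlgebraicClosure ℚ) ℂ)) ≫ 𝟙 _ =
        Spec.map (CommRingCat.ofHom (τ : ℂ →+* ℂ)) ≫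
          Spec.map (CommRingCat.ofHom (algebraMap (AlgebraicClosure ℚ) ℂ)) := by
    intro τ
    rw [Category.comp_id, ← Spec.map_comp, ← CommRingCat.ofHom_comp]
    congr 2
    ext a
    simp
  let ψ : ∀ τ : ℂ ≃ₐ[AlgebraicClosure ℚ] ℂ,
      pullback S₀.hom (Spec.map (CommRingCat.ofHom (algebraMap (AlgebraicClosure ℚ) ℂ))) ⟶
        pullback S₀.hom (Spec.map (CommRingCat.ofHom (algebraMap (AlgebraicClosure ℚ) ℂ))) :=
    fun τ => pullback.map _ _ _ _ (𝟙 _) (Spec.map (CommRingCat.ofHom (τ : ℂ →+* ℂ))) (𝟙 _)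
      (by simp) (htwist τ)
  have hψ1 : ∀ τ, ψ τ ≫ pullback.fst _ _ = pullback.fst _ _ := fun τ =>
    (pullback.lift_fst _ _ _).trans (Category.comp_id _)
  have hψ2 : ∀ τ, ψ τ ≫ pullback.snd _ _ =
      pullback.snd _ _ ≫ Spec.map (CommRingCat.ofHom (τ : ℂ →+* ℂ)) := fun τ =>
    pullback.lift_snd _ _ _
  -- the closed set `T = closure {s.pt | s ∈ Z}` of `S₀ ×_ℚ̄ Spec ℂ`
  set T : Set ↥(pullback S₀.hom
      (Spec.map (CommRingCat.ofHom (algebraMap (AlgebraicClosure ℚ) ℂ)))) :=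
    closure ((fun P : ComplexPoints ((baseChangeHom σ).obj S₀) => P.pt) ''
      {P : ComplexPoints ((baseChangeHom σ).obj S₀) | P.pt ∈ Zc}) with hTdef
  have hT : IsClosed T := isClosed_closure
  have hstabT : ∀ τ : ℂ ≃ₐ[AlgebraicClosure ℚ] ℂ,
      ∃ ψ' : pullback S₀.hom (Spec.map (CommRingCat.ofHom (algebraMap (AlgebraicClosure ℚ) ℂ))) ⟶
          pullback S₀.hom (Spec.map (CommRingCat.ofHom (algebraMap (AlgebraicClosure ℚ) ℂ))),
        ψ' ≫ pullback.fst _ _ = pullback.fst _ _ ∧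
        ψ' ≫ pullback.snd _ _ = pullback.snd _ _ ≫ Spec.map (CommRingCat.ofHom (τ : ℂ →+* ℂ)) ∧
        ∀ x ∈ T, ψ' x ∈ T := by
    intro τ
    refine ⟨ψ τ, hψ1 τ, hψ2 τ, ?_⟩
    have himg : (ψ τ) '' ((fun P : ComplexPoints ((baseChangeHom σ).obj S₀) => P.pt) ''
        {P : ComplexPoints ((baseChangeHom σ).obj S₀) | P.pt ∈ Zc}) ⊆
        (fun P : ComplexPoints ((baseChangeHom σ).obj S₀) => P.pt) ''
          {P : ComplexPoints ((baseChangeHom σ).obj S₀) | P.pt ∈ Zc} := by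
      rintro _ ⟨_, ⟨P, hP, rfl⟩, rfl⟩
      have hconj := pt_conjPoint_eq σ S₀ τ.symm P (ψ τ) (hψ1 τ) (by simpa using hψ2 τ)
      refine ⟨conjPoint σ S₀ τ.symm P, ?_, hconj⟩
      exact hstabZ τ.symm (hall τ.symm) ⟨P, hP, rfl⟩
    intro x hx
    exact closure_mono himg (image_closure_subset_closure_image (ψ τ).continuous ⟨x, hx, rfl⟩)
  obtain ⟨W, hW, hWT⟩ := exists_isClosed_preimage_fst_eq_of_stable hfix S₀ T hT hstabT
  refine ⟨W, hW, ?_⟩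
  ext P
  simp only [Set.mem_setOf_eq]
  constructor
  · intro hP
    have : P.pt ∈ T := subset_closure ⟨P, hP, rfl⟩
    rw [← hWT] at this
    exact this
  · intro hP
    have hPT : P.pt ∈ T := by rw [← hWT]; exact hP
    have hTZc : T ⊆ Zc := by
      refine closure_minimal ?_ hZc
      rintro _ ⟨Q, hQ, rfl⟩
      exact hQ
    exact hTZc hPT


end Literature.AlgebraicGeometry.HodgeTheory

end
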